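import Mathlib.Order.Filter.Germ.OrderedMonoid
import Mathlib.Topology.Instances.Real.Lemmas
import Mathlib.Algebra.Order.Group.Lattice
import Mathlib.Topology.Order.Basic
import Mathlib.Topology.MetricSpace.Basic
import Mathlib.Algebra.Field.Defs
import Mathlib.Algebra.GroupWithZero.Submonoid.CancelMulZero
import Mathlib.Algebra.BigOperators.Ring.Finset
import Mathlib.Algebra.Group.Submonoid.BigOperators
import Literature.NumberTheory.ConnesConsani.FrobeniusComposition
import HarnessLib

/-!
# Connes–Consani, *Geometry of the arithmetic site* (2016), §7.3–7.4: the germ semirings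
# `𝒢 ⊃ ℛ_ε(λλ',λ'), 𝔹_ε`, the tangential deformation `Id_ε` (Definition 7.6), Lemma 7.5,
# Proposition 7.4 and the remaining cases of Theorem 7.7 (= Thm. 1.2) — PROVED

Topic `Literature/NumberTheory/ConnesConsani`. Source: A. Connes, C. Consani, *Geometry of the
arithmetic site*, Adv. Math. 291 (2016) 274–329 = arXiv:1502.05580 [bib
`ConnesConsani2016ArithmeticSite`], §7.3 "`ℛ(λ) ⊗_{ℤ_min⁺} ℛ(λ')` for `λλ' ∈ ℚλ' + ℚ`", §7.4 "The
composition `Ψ(λ) ∘ Ψ(λ')`" (Adv. Math. numbering: Prop. 7.4, Lemma 7.5, Def. 7.6, Thm. 7.7,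
Lemma 7.8); announced in C. R. Math. 352 (2014) 971–975 [bib `ConnesConsani2014ArithmeticSite`] §4.2,
Thm. 4.1. Continues `FrobeniusComposition.lean` (Def. 7.1, `Ψ(λ)`, the composition recipe
`IsTensorReduction`/`IsComposition`, Prop. 7.3, Thm. 7.7 for `λλ' ∉ ℚλ' + ℚ` and for `λ ∈ ℚ`).

## The statements, verbatim (Adv. Math. numbering)

* **§7.3.** "We let `𝒢` be the semiring of germs of continuous functions from a neighborhood of
  `0 ∈ ℝ` to `ℝ₊^max`, endowed with the pointwise operations. We consider the sub-semiring
  `ℛ_ε(λλ',λ')` of `𝒢` generated, for fixed `q ∈ (0,1)`, by `q`, `q^{λ'}` and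
  `Fr_{1+ε}(q^{λλ'}) = q^{(1+ε)λλ'}`." **Proposition 7.4.** "Let `λ, λ' ∈ ℝ₊*` be irrational and such
  that `λλ' ∈ ℚλ' + ℚ`. (i) Let `ψ : ℛ(λ) × ℛ(λ') → ℛ_ε(λλ',λ')` be given by
  `ψ(q^{λi+j}, b) := q^{(1+ε)λλ'i} q^{λ'j} b` […]. Then `ψ` is bilinear,
  `ψ(aa',bb') = ψ(a,b)ψ(a',b')` […] and `ψ(r(λ)(x)a, b) = ψ(a, ℓ(λ')(x)b)` […]. (ii) Let `R` be a
  semiring and `φ : ℛ(λ) × ℛ(λ') → R` be a bilinear map such that `φ(aa',bb') = φ(a,b)φ(a',b')` […]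
  and `φ(r(λ)(x)a, b) = φ(a, ℓ(λ')(x)b)` […]. Then there exists a unique homomorphism
  `ρ : ℛ_ε(λλ',λ') → R` such that `φ = ρ ∘ ψ`."
* **Lemma 7.5.** "Let `F` be a semifield of characteristic `1` and `Z ∈ F`, `n ∈ ℕ`. Then the additive
  span of the `Z^i` for `i ∈ {0,…,n}` is the set of `Z(i,j) := Z^i + Z^j` for `0 ≤ i ≤ j ≤ n`. For any
  subset `S ⊂ {0,…,n}` one has `∑_S Z^k = Z(i,j)`, `i = inf(S)`, `j = max(S)`."
* **§7.4.** "Let `𝔹_ε` be the sub-semiring of `𝒢` generated, for fixed `q ∈ (0,1)`, by `q` and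
  `θ_{1+ε}(q) = q^{1+ε}`. It is independent, up to canonical isomorphism, of the choice of
  `q ∈ (0,1)`." **Definition 7.6.** "The tangential deformation of the identity correspondence is
  given by the triple `(𝔹_ε, ℓ_ε, r_ε)` where `ℓ_ε(q^n) := θ_{1+ε}(q^n)` and `r(q^n) := q^n`,
  `∀ n ∈ ℕ`." **Theorem 7.7.** "Let `λ, λ' ∈ ℝ₊*` such that `λλ' ∉ ℚ`. The composition of the
  Frobenius correspondences is then given by `Ψ(λ) ∘ Ψ(λ') = Ψ(λλ')`. The same equality holds if `λ`
  and `λ'` are rational. When `λ, λ'` are irrational and `λλ' ∈ ℚ`,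
  `Ψ(λ) ∘ Ψ(λ') = Id_ε ∘ Ψ(λλ')` where `Id_ε` is the tangential deformation of the identity
  correspondence." Proof (§7.4): "the reduction of `ℛ(λ) ⊗_{ℤ_min⁺} ℛ(λ')` is `ℛ_ε(λλ',λ')` and the
  left and right actions of `ℤ_min⁺` are given by `ℓ(q^n)X = q^{(1+ε)λλ'n}X`, `r(q^n)X = q^nX` […].
  Assume first that `λλ' ∉ ℚ`. […] the evaluation at `ε = 0` is an isomorphism `R → ℛ(α)`. For
  `λλ' = 1` the sub-semiring `R` […] is isomorphic to `𝔹_ε` with left and right actions given as in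
  Definition 7.6 and thus one gets `Ψ(λ) ∘ Ψ(λ⁻¹) = Id_ε`. Assume now that `α = λλ' ∈ ℚ`. Then the
  sub-semiring `R` […] is formed of finite sums of the form `σ(ε) = ∑ q^{(1+ε)αn_j + m_j}` […] (70)."

## Rendering (continuing `FrobeniusComposition.lean`)

* `𝒢` in exponent coordinates is `GermExp`: an exponent germ `f ∈ (𝓝 0).Germ ℝ` (Mathlib
  `Filter.Germ`; germs at `ε = 0`, TWO-sided, as the text's "neighborhood of `0 ∈ ℝ`" — this is what
  lets a sum of monomial germs remember both `inf S` and `max S`) standing for `q^{f(ε)}`, or `⊤`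
  for the zero germ; addition = pointwise `min` (`⊓` of germs), multiplication = pointwise `+`; a
  commutative, multiplicatively cancellative semiring of characteristic one. We allow all exponent
  germs, not only continuous ones: the sub-semirings of the paper are generated by germs of affine
  functions `q^{v + sε}` (`gaff v s`), e.g. `q = gaff 1 0`, `q^{λ'} = gaff λ' 0`,
  `Fr_{1+ε}(q^c) = q^{(1+ε)c} = gaff c c`, and nothing else is ever used. `𝔹_ε = Beps`,
  `ℛ_ε(λλ',λ') = epsSemiring λ λ'` and the semiring of (70) `germSemiring α` are LITERALLY the
  `Subsemiring.closure`s of the printed generators; `Id_ε = idEps` (Def. 7.6), the correspondence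
  (70) = `germComp α`, and `germComp 1 = idEps` holds by `rfl`.
* Monomials are indexed by pairs `t = (a, β)`, `a ∈ ℕ` (the exponent of `U = φ(q^λ,1)` resp. of
  `q^{(1+ε)λλ'}`) and `β ∈ ℕλ' + ℕ` (collecting `V^bW^c`, "The products `V^b W^c` only depend on
  `β`"), with value `val(t) = λλ'a + β` (`mval`); on the germ side the monomial is
  `q^{(1+ε)λλ'a + β}` (`epsMono`), on the `R` side `φ(q^{aλ}, q^β)` (`rMono`, = `Phi` of the companion
  file). The heart of Prop. 7.4 (ii) — "`∑_S U_ε^aV_ε^bW_ε^c = ∑_{S'} U_ε^aV_ε^bW_ε^c ⟹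
  ∑_S U^aV^bW^c = ∑_{S'} U^aV^bW^c`" — is proved through a CANONICAL FORM: under the two absorption
  rules (smaller value absorbs = the addition rule (60)/(73); a monomial whose `a` lies between two
  monomials of the same value is absorbed = the content of Lemma 7.5) a finite sum of monomials equals
  `m(t₋) + m(t₊)` (`sum_eq_two_of_absorb`), and on the germ side `(u, a₋, a₊)` is recovered from the
  sum (`epsSum_inj`, the printed "`⟺ inf(S) = inf(S')` and `max(S) = max(S')`"). On the `R` side the
  middle absorption is `Y^{p+r} = X^r Z^p ⟹ Y ≤ X + Z` (`add_eq_of_pow_eq_mul_pow`), which is how we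
  route Lemma 7.5 without the semifield of fractions `Frac(R)` of the printed proof (the homogeneous
  form `ConnesConsani2016_lemma_7_5_homog`; the printed form in a semifield of characteristic one is
  `ConnesConsani2016_lemma_7_5` / `_span`). A by-product of this route: the arithmetic structure of
  `F(u)` (the lcm `m` of the denominators of `s, t` with `λλ' = sλ' + t`) is not needed, so our
  Prop. 7.4 (ii) holds for every irrational `λ` and every `λ' > 0` — the printed hypotheses
  `λ' ∉ ℚ`, `λλ' ∈ ℚλ' + ℚ` are not used (when `λλ' ∉ ℚλ' + ℚ`, `ℛ_ε(λλ',λ')` is canonically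
  `ℛ(λλ',λ')` and this is Prop. 7.3 again).
* What is PROVED here: `𝒢` is a multiplicatively cancellative commutative semiring of characteristic
  one (`GermExp.instCommSemiring`, `instIsCancelMulZero`); **Def. 7.6** `idEps` is a reduced
  correspondence; **Lemma 7.5** (`ConnesConsani2016_lemma_7_5_homog`, `ConnesConsani2016_lemma_7_5`,
  `ConnesConsani2016_lemma_7_5_span`); **Prop. 7.4 (i)** (`ConnesConsani2016_prop_7_4_i`) and **(ii)**
  (`ConnesConsani2016_prop_7_4_ii`; packaged `ConnesConsani2016_prop_7_4 : IsTensorReduction Ψ(λ) Ψ(λ')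
  ℛ_ε(λλ',λ') ψ` for `λ ∉ ℚ`); **Theorem 7.7**: for `λ ∉ ℚ` the composition `Ψ(λ) ∘ Ψ(λ')` is the
  correspondence (70) with `α = λλ'` (`ConnesConsani2016_thm_7_7_irrational_left`); "the evaluation at
  `ε = 0` is an isomorphism" `(70) ≅ Ψ(α)` for `α ∉ ℚ` (`germComp_iso_frob`), whence
  `Ψ(λ) ∘ Ψ(λ') = Ψ(λλ')` for `λ ∉ ℚ`, `λλ' ∉ ℚ` (`…_irrational`) and, with the companion file's
  rational case, **the first sentence of Thm. 7.7 in full** (`ConnesConsani2016_thm_7_7`);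
  "`Ψ(λ) ∘ Ψ(λ⁻¹) = Id_ε`" (`…_inverse`); and the third sentence in the form the proof computes it,
  `Ψ(λ) ∘ Ψ(λ') = (70)` for `λ, λ' ∉ ℚ`, `λλ' ∈ ℚ` (`…_resonant`).
* NOT typed: Lemma 7.8 (the reduction of `𝔹_ε ⊗_{ℤ_min⁺} ℛ(α)`) and with it the identification
  "(70) `= Id_ε ∘ Ψ(λλ')`" for `λλ' ∈ ℚ ∖ {1}` (the last clause of the printed third sentence);
  Lemma 7.2 (needs §6's `Conv(ℕ × ℕ)`).
-/

noncomputable section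

open Set Tropical Filter Topology

namespace Literature.NumberTheory.ConnesConsani

local notation "𝕋" => RMaxExp
local notation "ℕ̄" => ZMinPlus

/-! ## The germ semiring `𝒢` in exponent coordinates -/

/-- Exponent germs: germs at `ε = 0` of real functions of `ε` (the exponents `f(ε)` of germs
`q^{f(ε)}`). [cite: ConnesConsani2016ArithmeticSite, §7.3 ("`𝒢` the semiring of germs of continuous functions from a neighborhood of `0 ∈ ℝ` to `ℝ₊^max`")] -/
abbrev EGerm : Type := (𝓝 (0 : ℝ)).Germ ℝ

/-- **The germ semiring `𝒢`** in exponent coordinates: "the semiring of germs of continuous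
functions from a neighborhood of `0 ∈ ℝ` to `ℝ₊^max`, endowed with the pointwise operations" —
an element is `q^{f}` for an exponent germ `f` (pointwise `∨` = `min` of exponents, product = `+`
of exponents) or the zero germ (`⊤`). (We allow all germs of exponent functions; the sub-semirings
of the paper are generated by germs of affine functions of `ε`.)
[cite: ConnesConsani2016ArithmeticSite, §7.3 (before Prop. 7.4)] -/
structure GermExp : Type where
  /-- the exponent germ (`⊤` for the zero element) -/
  val : WithTop EGerm

namespace GermExp

/-- Extensionality. [cite: ConnesConsani2016ArithmeticSite, §7.3] -/
@[ext] theorem ext {x y : GermExp} (h : x.val = y.val) : x = y := by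
  cases x; cases y; congr

/-- `+` distributes over `⊓` in `WithTop` of the exponent germs. [cite: ConnesConsani2016ArithmeticSite, §7.3 (`𝒢` is a semiring)] -/
theorem withTop_add_inf (a b c : WithTop EGerm) : a + b ⊓ c = (a + b) ⊓ (a + c) := by
  cases a with
  | top => simp
  | coe a =>
    cases b with
    | top => simp
    | coe b =>
      cases c with
      | top => simp
      | coe c =>
        rw [← WithTop.coe_inf, ← WithTop.coe_add, ← WithTop.coe_add, ← WithTop.coe_add,
          ← WithTop.coe_inf, add_inf b c a]

/-- The zero germ. [cite: ConnesConsani2016ArithmeticSite, §7.3] -/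
instance : Zero GermExp := ⟨⟨⊤⟩⟩
/-- The germ `1 = q^0`. [cite: ConnesConsani2016ArithmeticSite, §7.3] -/
instance : One GermExp := ⟨⟨((0 : EGerm) : WithTop EGerm)⟩⟩
/-- Pointwise `∨` = `min` of exponents. [cite: ConnesConsani2016ArithmeticSite, §7.3 (pointwise operations)] -/
instance : Add GermExp := ⟨fun x y => ⟨x.val ⊓ y.val⟩⟩
/-- Pointwise product = `+` of exponents. [cite: ConnesConsani2016ArithmeticSite, §7.3 (pointwise operations)] -/
instance : Mul GermExp := ⟨fun x y => ⟨x.val + y.val⟩⟩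

/-- `𝒢` is a commutative semiring (pointwise operations). [cite: ConnesConsani2016ArithmeticSite, §7.3 (before Prop. 7.4)] -/
instance : CommSemiring GermExp where
  add := (· + ·)
  zero := 0
  mul := (· * ·)
  one := 1
  nsmul_zero _ := rfl
  nsmul_succ _ _ := rfl
  npow_zero _ := rfl
  npow_succ _ _ := rfl
  add_assoc x y z := ext (inf_assoc _ _ _)
  zero_add x := ext (top_inf_eq _)
  add_zero x := ext (inf_top_eq _)
  add_comm x y := ext (inf_comm _ _)
  mul_assoc x y z := ext (add_assoc _ _ _)
  one_mul x := ext (zero_add _)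
  mul_one x := ext (add_zero _)
  mul_comm x y := ext (add_comm _ _)
  zero_mul x := ext (WithTop.top_add _)
  mul_zero x := ext (WithTop.add_top _)
  left_distrib x y z := ext (withTop_add_inf _ _ _)
  right_distrib x y z := ext (by
    show (x.val ⊓ y.val) + z.val = (x.val + z.val) ⊓ (y.val + z.val)
    rw [add_comm, withTop_add_inf, add_comm z.val, add_comm z.val])
  nsmul := nsmulRec
  npow := npowRec

/-- The exponent of `0` is `⊤`. [cite: ConnesConsani2016ArithmeticSite, §7.3] -/
@[simp] theorem val_zero : (0 : GermExp).val = ⊤ := rfl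
/-- The exponent of `1` is `0`. [cite: ConnesConsani2016ArithmeticSite, §7.3] -/
@[simp] theorem val_one : (1 : GermExp).val = ((0 : EGerm) : WithTop EGerm) := rfl
/-- Exponent of a sum. [cite: ConnesConsani2016ArithmeticSite, §7.3] -/
@[simp] theorem val_add (x y : GermExp) : (x + y).val = x.val ⊓ y.val := rfl
/-- Exponent of a product. [cite: ConnesConsani2016ArithmeticSite, §7.3] -/
@[simp] theorem val_mul (x y : GermExp) : (x * y).val = x.val + y.val := rfl

/-- `𝒢` is multiplicatively cancellative (germs of nowhere-vanishing functions cancel).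
[cite: ConnesConsani2016ArithmeticSite, §7.3 (Prop. 7.4 (ii): `ℛ_ε` "embed[s] in the semifield of fractions")] -/
instance : IsCancelMulZero GermExp where
  mul_left_cancel_of_ne_zero := by
    intro a ha b c h
    apply ext
    have h' : a.val + b.val = a.val + c.val := congrArg GermExp.val h
    have hat : a.val ≠ ⊤ := fun h0 => ha (ext h0)
    exact (WithTop.add_left_inj hat).1 h'
  mul_right_cancel_of_ne_zero := by
    intro b hb a c h
    apply ext
    have h' : a.val + b.val = c.val + b.val := congrArg GermExp.val h
    have hbt : b.val ≠ ⊤ := fun h0 => hb (ext h0)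
    exact (WithTop.add_right_inj hbt).1 h'

/-- `𝒢` has characteristic one. [cite: ConnesConsani2016ArithmeticSite, §7.3] -/
theorem one_add_one : (1 : GermExp) + 1 = 1 := ext (inf_idem _)

end GermExp

/-- The germ `q^{g}` for an exponent germ `g`. [cite: ConnesConsani2016ArithmeticSite, §7.3] -/
def gexp (g : EGerm) : GermExp := ⟨(g : WithTop EGerm)⟩

/-- The exponent of `q^g`. [cite: ConnesConsani2016ArithmeticSite, §7.3] -/
@[simp] theorem gexp_val (g : EGerm) : (gexp g).val = (g : WithTop EGerm) := rfl

/-- `q^g q^h = q^{g+h}`. [cite: ConnesConsani2016ArithmeticSite, §7.3 (pointwise operations)] -/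
@[simp] theorem gexp_mul (g h : EGerm) : gexp g * gexp h = gexp (g + h) :=
  GermExp.ext (by simp [← WithTop.coe_add])

/-- `q^g ∨ q^h = q^{g ⊓ h}`. [cite: ConnesConsani2016ArithmeticSite, §7.3 (pointwise operations)] -/
@[simp] theorem gexp_add (g h : EGerm) : gexp g + gexp h = gexp (g ⊓ h) :=
  GermExp.ext (by simp [← WithTop.coe_inf])

/-- `q^0 = 1`. [cite: ConnesConsani2016ArithmeticSite, §7.3] -/
@[simp] theorem gexp_zero : gexp 0 = 1 := rfl

/-- `q^g ≠ 0`. [cite: ConnesConsani2016ArithmeticSite, §7.3] -/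
theorem gexp_ne_zero (g : EGerm) : gexp g ≠ 0 := fun h => by
  have := congrArg GermExp.val h; simp at this

/-- `q^g = q^h ↔ g = h`. [cite: ConnesConsani2016ArithmeticSite, §7.3] -/
theorem gexp_injective : Function.Injective gexp := fun g h e => by
  have := congrArg GermExp.val e
  simpa using this

/-- `(q^g)^n = q^{ng}`. [cite: ConnesConsani2016ArithmeticSite, §7.3] -/
theorem gexp_pow (g : EGerm) (n : ℕ) : gexp g ^ n = gexp (n • g) := by
  induction n with
  | zero => simp
  | succ n ih => rw [pow_succ, ih, gexp_mul, _root_.succ_nsmul]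

/-- Every element of `𝒢` is `0` or some `q^g`. [cite: ConnesConsani2016ArithmeticSite, §7.3] -/
theorem eq_zero_or_eq_gexp (x : GermExp) : x = 0 ∨ ∃ g, x = gexp g := by
  obtain ⟨v⟩ := x
  cases v with
  | top => exact Or.inl rfl
  | coe g => exact Or.inr ⟨g, rfl⟩

/-! ## Germs of affine exponents `q^{v + sε}` -/

/-- The exponent germ of `ε ↦ v + sε`. [cite: ConnesConsani2016ArithmeticSite, §7.3 (`Fr_{1+ε}(q^{λλ'}) = q^{(1+ε)λλ'}`)] -/
def affG (v s : ℝ) : EGerm := ((fun ε : ℝ => v + s * ε : ℝ → ℝ) : EGerm)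

/-- **`q^{v + sε} ∈ 𝒢`**: e.g. `q = gaff 1 0`, `q^{λ'} = gaff λ' 0`, `Fr_{1+ε}(q^{c}) = q^{(1+ε)c} =
gaff c c`. [cite: ConnesConsani2016ArithmeticSite, §7.3 (generators of `ℛ_ε(λλ',λ')`) and §7.4 (generators of `𝔹_ε`)] -/
def gaff (v s : ℝ) : GermExp := gexp (affG v s)

/-- `(v + sε) + (v' + s'ε) = (v+v') + (s+s')ε`. [cite: ConnesConsani2016ArithmeticSite, §7.3] -/
theorem affG_add (v s v' s' : ℝ) : affG v s + affG v' s' = affG (v + v') (s + s') := by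
  show (((fun ε : ℝ => v + s * ε) + fun ε : ℝ => v' + s' * ε : ℝ → ℝ) : EGerm) = _
  unfold affG; congr 1; funext ε; simp only [Pi.add_apply]; ring

/-- The germ of `ε ↦ 0`. [cite: ConnesConsani2016ArithmeticSite, §7.3] -/
theorem affG_zero : affG 0 0 = 0 := by
  unfold affG
  have : (fun ε : ℝ => (0 : ℝ) + 0 * ε) = (0 : ℝ → ℝ) := by funext ε; simp
  rw [this]; rfl

/-- For `v < v'` the germ of `min (v + sε, v' + s'ε)` at `0` is `v + sε` ("for `ε` small enough
one has `(1+ε)αn_{j₀} + m_{j₀} < (1+ε)αn_j + m_j`").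
[cite: ConnesConsani2016ArithmeticSite, §7.4 (proof of Thm. 7.7)] -/
theorem affG_inf_of_lt {v v' : ℝ} (h : v < v') (s s' : ℝ) : affG v s ⊓ affG v' s' = affG v s := by
  show (((fun ε : ℝ => (v + s * ε) ⊓ (v' + s' * ε)) : ℝ → ℝ) : EGerm) = _
  unfold affG
  refine Germ.coe_eq.2 ?_
  have hc : Continuous fun ε : ℝ => (v' + s' * ε) - (v + s * ε) := by continuity
  have h0 : (0 : ℝ) < (v' + s' * 0) - (v + s * 0) := by simpa using h
  have hev := (hc.tendsto 0).eventually_const_lt h0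
  filter_upwards [hev] with ε hε
  exact min_eq_left (by linarith)

/-- `q^{v+sε} q^{v'+s'ε} = q^{(v+v') + (s+s')ε}`. [cite: ConnesConsani2016ArithmeticSite, §7.3] -/
@[simp] theorem gaff_mul (v s v' s' : ℝ) : gaff v s * gaff v' s' = gaff (v + v') (s + s') := by
  unfold gaff; rw [gexp_mul, affG_add]

/-- `q^{0 + 0ε} = 1`. [cite: ConnesConsani2016ArithmeticSite, §7.3] -/
@[simp] theorem gaff_zero : gaff 0 0 = 1 := by unfold gaff; rw [affG_zero, gexp_zero]

/-- `q^{v+sε} ≠ 0`. [cite: ConnesConsani2016ArithmeticSite, §7.3] -/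
theorem gaff_ne_zero (v s : ℝ) : gaff v s ≠ 0 := gexp_ne_zero _

/-- For `v < v'`: `q^{v+sε} ∨ q^{v'+s'ε} = q^{v+sε}` in `𝒢`. [cite: ConnesConsani2016ArithmeticSite, §7.4 (proof of Thm. 7.7)] -/
theorem gaff_add_of_lt {v v' : ℝ} (h : v < v') (s s' : ℝ) : gaff v s + gaff v' s' = gaff v s := by
  unfold gaff; rw [gexp_add, affG_inf_of_lt h]

/-- For `v' < v`: `q^{v+sε} ∨ q^{v'+s'ε} = q^{v'+s'ε}` in `𝒢`. [cite: ConnesConsani2016ArithmeticSite, §7.4 (proof of Thm. 7.7)] -/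
theorem gaff_add_of_gt {v v' : ℝ} (h : v' < v) (s s' : ℝ) : gaff v s + gaff v' s' = gaff v' s' := by
  rw [add_comm, gaff_add_of_lt h]

/-- `q^{v+sε} ∨ q^{v+sε} = q^{v+sε}`. [cite: ConnesConsani2016ArithmeticSite, §7.3] -/
theorem gaff_add_self (v s : ℝ) : gaff v s + gaff v s = gaff v s := by
  unfold gaff; rw [gexp_add, inf_idem]

/-- `(q^{v+sε})^n = q^{nv + nsε}`. [cite: ConnesConsani2016ArithmeticSite, §7.3] -/
theorem gaff_pow (v s : ℝ) (n : ℕ) : gaff v s ^ n = gaff (n * v) (n * s) := by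
  induction n with
  | zero => simp
  | succ n ih => rw [pow_succ, ih, gaff_mul]; push_cast; ring_nf

/-- Germ equality of affine exponents forces equal values and slopes.
[cite: ConnesConsani2016ArithmeticSite, §7.3 (proof of Prop. 7.4 (i): `δ` "is an isomorphism with its image")] -/
theorem gaff_injective {v s v' s' : ℝ} (h : gaff v s = gaff v' s') : v = v' ∧ s = s' := by
  have h1 : affG v s = affG v' s' := gexp_injective h
  have h2 : (fun ε : ℝ => v + s * ε) =ᶠ[𝓝 0] fun ε : ℝ => v' + s' * ε := Germ.coe_eq.1 h1
  have hv : v = v' := by simpa using h2.eq_of_nhds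
  refine ⟨hv, ?_⟩
  obtain ⟨δ, hδ, hball⟩ := Metric.eventually_nhds_iff.1 h2
  have hε : dist (δ / 2) (0 : ℝ) < δ := by
    rw [Real.dist_eq, sub_zero, abs_of_pos (by positivity)]; linarith
  have := hball hε
  simp only at this
  have hδ2 : (δ / 2 : ℝ) ≠ 0 := by positivity
  rw [hv] at this
  exact mul_right_cancel₀ hδ2 (by linarith)

/-! ## Morphisms `ℤ_min⁺ → 𝒢`, `q^n ↦ q^{n(v + sε)}` -/

/-- The map underlying `q^n ↦ q^{nv + nsε}`. [cite: ConnesConsani2016ArithmeticSite, Def. 7.6 (`ℓ_ε(q^n) := θ_{1+ε}(q^n)`, `r(q^n) := q^n`)] -/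
def gpowFun (v s : ℝ) (x : ℕ̄) : GermExp :=
  ⟨(untrop x).map fun n : ℕ => affG (n * v) (n * s)⟩

/-- `q^n ↦ q^{nv + nsε}`. [cite: ConnesConsani2016ArithmeticSite, Def. 7.6] -/
@[simp] theorem gpowFun_nexp (v s : ℝ) (n : ℕ) : gpowFun v s (nexp n) = gaff (n * v) (n * s) := rfl

/-- `0 ↦ 0`. [cite: ConnesConsani2016ArithmeticSite, Def. 7.6] -/
@[simp] theorem gpowFun_zero (v s : ℝ) : gpowFun v s 0 = 0 := rfl

/-- The semiring morphism `ℤ_min⁺ → 𝒢`, `q^n ↦ (q^{v+sε})^n` (`v > 0`): for `(v,s) = (1,1)` this is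
`ℓ_ε = θ_{1+ε}`, for `(1,0)` it is `r_ε`, for `(λλ', λλ')` and `(1, 0)` the left and right actions
on `ℛ_ε(λλ',λ')`. [cite: ConnesConsani2016ArithmeticSite, Def. 7.6 and §7.4 (eq. (70))] -/
def gpowHom (v s : ℝ) (hv : 0 < v) : ℕ̄ →+* GermExp where
  toFun := gpowFun v s
  map_zero' := rfl
  map_one' := by rw [← nexp_zero, gpowFun_nexp]; simp
  map_mul' x y := by
    rcases eq_zero_or_eq_nexp x with rfl | ⟨a, rfl⟩ <;>
      rcases eq_zero_or_eq_nexp y with rfl | ⟨b, rfl⟩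
    · simp
    · simp
    · simp
    · rw [nexp_mul, gpowFun_nexp, gpowFun_nexp, gpowFun_nexp, gaff_mul]; push_cast; ring_nf
  map_add' x y := by
    rcases eq_zero_or_eq_nexp x with rfl | ⟨a, rfl⟩ <;>
      rcases eq_zero_or_eq_nexp y with rfl | ⟨b, rfl⟩
    · simp
    · simp
    · simp
    · rw [nexp_add, gpowFun_nexp, gpowFun_nexp, gpowFun_nexp]
      rcases lt_trichotomy a b with h | rfl | h
      · rw [min_eq_left h.le, gaff_add_of_lt (mul_lt_mul_of_pos_right (Nat.cast_lt.2 h) hv)]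
      · rw [min_self, gaff_add_self]
      · rw [min_eq_right h.le, add_comm, gaff_add_of_lt (mul_lt_mul_of_pos_right (Nat.cast_lt.2 h) hv)]

/-- `q^n ↦ q^{nv+nsε}`. [cite: ConnesConsani2016ArithmeticSite, Def. 7.6] -/
@[simp] theorem gpowHom_nexp (v s : ℝ) (hv : 0 < v) (n : ℕ) : gpowHom v s hv (nexp n) = gaff (n * v) (n * s) := rfl

/-- `0 ↦ 0`. [cite: ConnesConsani2016ArithmeticSite, Def. 7.6] -/
@[simp] theorem gpowHom_zero' (v s : ℝ) (hv : 0 < v) : gpowHom v s hv 0 = 0 := rfl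

/-- The kernel condition of Def. 7.1 for `q^n ↦ q^{n(v+sε)}`. [cite: ConnesConsani2016ArithmeticSite, Def. 7.1 and Def. 7.6] -/
theorem gpowHom_eq_zero_iff (v s : ℝ) (hv : 0 < v) (x : ℕ̄) : gpowHom v s hv x = 0 ↔ x = 0 := by
  rcases eq_zero_or_eq_nexp x with rfl | ⟨n, rfl⟩
  · simp
  · simp only [gpowHom_nexp, nexp_ne_zero, iff_false]
    exact gaff_ne_zero _ _

/-- `(q^{v+sε})^n` lies in any sub-semiring containing `q^{v+sε}`. [cite: ConnesConsani2016ArithmeticSite, §7.4 (sub-semirings generated by germs)] -/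
theorem gpowHom_mem {v s : ℝ} (hv : 0 < v) {S : Subsemiring GermExp} (h : gaff v s ∈ S) (x : ℕ̄) :
    gpowHom v s hv x ∈ S := by
  rcases eq_zero_or_eq_nexp x with rfl | ⟨n, rfl⟩
  · simp
  · rw [gpowHom_nexp, ← gaff_pow]
    exact pow_mem h n

/-! ## `𝔹_ε` and the tangential deformation of the identity correspondence (Definition 7.6) -/

/-- **`𝔹_ε`**: "the sub-semiring of `𝒢` generated, for fixed `q ∈ (0,1)`, by `q` and
`θ_{1+ε}(q) = q^{1+ε}`. It is independent, up to canonical isomorphism, of the choice of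
`q ∈ (0,1)`." (`q = q^{1 + 0ε}`, `q^{1+ε} = q^{1 + 1ε}`.) [cite: ConnesConsani2016ArithmeticSite, §7.4 (before Def. 7.6)] -/
abbrev Beps : Subsemiring GermExp :=
  Subsemiring.closure {gaff 1 0, gaff 1 1}

/-- `q ∈ 𝔹_ε`. [cite: ConnesConsani2016ArithmeticSite, §7.4] -/
theorem q_mem_Beps : gaff 1 0 ∈ Beps := Subsemiring.subset_closure (by simp)

/-- `q^{1+ε} ∈ 𝔹_ε`. [cite: ConnesConsani2016ArithmeticSite, §7.4] -/
theorem qeps_mem_Beps : gaff 1 1 ∈ Beps := Subsemiring.subset_closure (by simp)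

/-- **`ℓ_ε`**: "`ℓ_ε(q^n) := θ_{1+ε}(q^n)`" `= q^{(1+ε)n}`. [cite: ConnesConsani2016ArithmeticSite, Def. 7.6] -/
def epsEll : ℕ̄ →+* Beps :=
  (gpowHom 1 1 one_pos).codRestrict Beps (gpowHom_mem one_pos qeps_mem_Beps)

/-- **`r_ε`**: "`r(q^n) := q^n`". [cite: ConnesConsani2016ArithmeticSite, Def. 7.6] -/
def epsR : ℕ̄ →+* Beps :=
  (gpowHom 1 0 one_pos).codRestrict Beps (gpowHom_mem one_pos q_mem_Beps)

/-- `ℓ_ε` in `𝒢`. [cite: ConnesConsani2016ArithmeticSite, Def. 7.6] -/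
@[simp] theorem coe_epsEll (x : ℕ̄) : (epsEll x : GermExp) = gpowHom 1 1 one_pos x := rfl
/-- `r_ε` in `𝒢`. [cite: ConnesConsani2016ArithmeticSite, Def. 7.6] -/
@[simp] theorem coe_epsR (x : ℕ̄) : (epsR x : GermExp) = gpowHom 1 0 one_pos x := rfl

open Pointwise in
/-- A sub-semiring generated by a set is generated, inside itself, by that set: if every generator
is a product `ℓ(x) r(y)` then `closure (range ℓ * range r) = ⊤` in the subtype.
[cite: ConnesConsani2016ArithmeticSite, Def. 7.1 ("`R` is generated by `ℓ(ℤ_min⁺)r(ℤ_min⁺)`")] -/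
theorem closure_range_mul_range_eq_top {A : Type*} [CommSemiring A] {gens : Set A}
    (ell r : ℕ̄ →+* Subsemiring.closure gens)
    (hgen : ∀ g (hg : g ∈ gens), ∃ x y, (⟨g, Subsemiring.subset_closure hg⟩ : Subsemiring.closure gens) = ell x * r y) :
    Subsemiring.closure (Set.range ell * Set.range r) = ⊤ := by
  refine eq_top_iff.2 fun z hz0 => ?_
  clear hz0
  obtain ⟨z, hz⟩ := z
  induction hz using Subsemiring.closure_induction with
  | mem g hg =>
    obtain ⟨x, y, hxy⟩ := hgen g hg
    rw [hxy]
    exact Subsemiring.subset_closure (Set.mul_mem_mul ⟨x, rfl⟩ ⟨y, rfl⟩)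
  | zero => exact Subsemiring.zero_mem _
  | one => exact Subsemiring.one_mem _
  | add a b ha hb iha ihb => exact Subsemiring.add_mem _ iha ihb
  | mul a b ha hb iha ihb => exact Subsemiring.mul_mem _ iha ihb

/-- **Connes–Consani 2016, Definition 7.6 (= CRAS 2014 §4.2)**: "The tangential deformation of the
identity correspondence is given by the triple `(𝔹_ε, ℓ_ε, r_ε)` where `ℓ_ε(q^n) := θ_{1+ε}(q^n)`
and `r(q^n) := q^n`, `∀ n ∈ ℕ`." — a reduced correspondence `Id_ε`.
[cite: ConnesConsani2016ArithmeticSite, Def. 7.6] -/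
abbrev idEps : ReducedCorrespondence where
  R := Beps
  ell := epsEll
  r := epsR
  ell_eq_zero_iff x := by
    rw [← Subtype.coe_inj, Subsemiring.coe_zero, coe_epsEll]
    exact gpowHom_eq_zero_iff 1 1 one_pos x
  r_eq_zero_iff x := by
    rw [← Subtype.coe_inj, Subsemiring.coe_zero, coe_epsR]
    exact gpowHom_eq_zero_iff 1 0 one_pos x
  closure_eq_top := by
    refine closure_range_mul_range_eq_top epsEll epsR fun g hg => ?_
    simp only [Set.mem_insert_iff, Set.mem_singleton_iff] at hg
    rcases hg with rfl | rfl
    · exact ⟨1, nexp 1, Subtype.ext (by simp)⟩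
    · exact ⟨nexp 1, 1, Subtype.ext (by simp)⟩

/-! ## `ℛ_ε(λλ', λ')` -/

/-- **`ℛ_ε(λλ', λ')`**: "the sub-semiring of `𝒢` generated, for fixed `q ∈ (0,1)`, by `q`, `q^{λ'}`
and `Fr_{1+ε}(q^{λλ'}) = q^{(1+ε)λλ'}`". [cite: ConnesConsani2016ArithmeticSite, §7.3 (before Prop. 7.4)] -/
abbrev epsSemiring (l l' : ℝ) : Subsemiring GermExp :=
  Subsemiring.closure {gaff 1 0, gaff l' 0, gaff (l * l') (l * l')}

/-! ## Lemma 7.5: the additive span of the powers of an element in characteristic one -/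

section Lemma75

variable {R : Type*} [CommSemiring R]

/-- Idempotency. [folklore] -/
private theorem add_self' (h1 : (1 : R) + 1 = 1) (x : R) : x + x = x :=
  add_self_of_one_add_one h1 x

/-- A term is absorbed by its sum. [folklore] -/
private theorem term_add_sum (h1 : (1 : R) + 1 = 1) {ι : Type*} (A : Finset ι) (f : ι → R) {i : ι}
    (hi : i ∈ A) : f i + ∑ j ∈ A, f j = ∑ j ∈ A, f j := by
  classical
  rw [← Finset.add_sum_erase A f hi, ← add_assoc, add_self' h1]

/-- Termwise absorption. [folklore] -/
private theorem sum_add_of_forall {ι : Type*} (A : Finset ι) (f : ι → R) (b : R)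
    (h : ∀ i ∈ A, f i + b = b) : (∑ j ∈ A, f j) + b = b := by
  classical
  induction A using Finset.induction_on with
  | empty => simp
  | insert a A ha ih =>
    rw [Finset.sum_insert ha, add_assoc, ih fun i hi => h i (Finset.mem_insert_of_mem hi),
      h a (Finset.mem_insert_self a A)]

/-- Products are monotone for the order `x ≤ y :⟺ x + y = y` of an idempotent semiring.
[cite: ConnesConsani2016ArithmeticSite, Lemma 7.5 (proof, eq. (67)–(69))] -/
theorem mul_absorb (h1 : (1 : R) + 1 = 1) {x y x' y' : R} (h : x + y = y) (h' : x' + y' = y') :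
    x * x' + y * y' = y * y' := by
  have e : y * y' = x * x' + (x * y' + y * x' + y * y') := by
    conv_lhs => rw [← h, ← h']
    ring
  rw [e, ← add_assoc, add_self' h1]

/-- `x^a ≤ (x + y)^a` in an idempotent semiring. [cite: ConnesConsani2016ArithmeticSite, Lemma 7.5 (proof)] -/
theorem pow_add_pow_add_eq (h1 : (1 : R) + 1 = 1) (x y : R) (a : ℕ) :
    x ^ a + (x + y) ^ a = (x + y) ^ a := by
  induction a with
  | zero => simp [h1]
  | succ a ih =>
    rw [pow_succ, pow_succ]
    exact mul_absorb h1 ih (by rw [← add_assoc, add_self' h1])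

/-- **Connes–Consani 2016, Lemma 7.5, homogeneous form** (no fractions): in a multiplicatively
cancellative semiring of characteristic one, for `S ⊆ {0,…,n}` non-empty with `i = inf S`,
`k = max S`: `∑_{j ∈ S} P^j Q^{n−j} = P^i Q^{n−i} + P^k Q^{n−k}` — the printed
"`∑_S Z^k = Z(i,j)`, `i = inf S`, `j = max S`" for `Z = P/Q`, cleared of denominators. Proof as
printed in substance (`Z(i,j)s(i,j) = s(i,j)s(i,j)`), routed through `(x+y)^m = x^m + y^m`.
[cite: ConnesConsani2016ArithmeticSite, Lemma 7.5] -/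
theorem ConnesConsani2016_lemma_7_5_homog [IsCancelMulZero R] (h1 : (1 : R) + 1 = 1) (P Q : R)
    {n : ℕ} (S : Finset ℕ) (hS : S.Nonempty) (hSn : ∀ j ∈ S, j ≤ n) :
    ∑ j ∈ S, P ^ j * Q ^ (n - j) =
      P ^ (S.min' hS) * Q ^ (n - S.min' hS) + P ^ (S.max' hS) * Q ^ (n - S.max' hS) := by
  set i := S.min' hS with hi
  set k := S.max' hS with hk
  have hik : i ≤ k := Finset.min'_le_max' S hS  -- may need args
  have hkn : k ≤ n := hSn _ (Finset.max'_mem S hS)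
  have hjS : ∀ j ∈ S, i ≤ j ∧ j ≤ k := fun j hj => ⟨Finset.min'_le S j hj, Finset.le_max' S j hj⟩
  -- factor out `P^i Q^{n-k}`
  have hfac : ∀ j ∈ S, P ^ j * Q ^ (n - j) = P ^ i * Q ^ (n - k) * (P ^ (j - i) * Q ^ (k - j)) := by
    intro j hj
    obtain ⟨h1j, h2j⟩ := hjS j hj
    rw [show P ^ j = P ^ i * P ^ (j - i) by rw [← pow_add, Nat.add_sub_cancel' h1j],
      show Q ^ (n - j) = Q ^ (n - k) * Q ^ (k - j) by rw [← pow_add]; congr 1; omega]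
    ring
  rw [Finset.sum_congr rfl hfac, ← Finset.mul_sum]
  -- the inner sum is `(P + Q)^(k - i) = P^(k-i) + Q^(k-i)`
  set m := k - i with hm
  have hT : (P + Q) ^ m = P ^ m + Q ^ m := add_pow_charOne h1 P Q m
  have hinner : ∑ j ∈ S, P ^ (j - i) * Q ^ (k - j) = P ^ m + Q ^ m := by
    -- `T ≤ Σ`
    have hle : (P ^ m + Q ^ m) + ∑ j ∈ S, P ^ (j - i) * Q ^ (k - j) = ∑ j ∈ S, P ^ (j - i) * Q ^ (k - j) := by
      rw [add_assoc]
      have e1 : Q ^ m = P ^ (i - i) * Q ^ (k - i) := by simp [hm]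
      have e2 : P ^ m = P ^ (k - i) * Q ^ (k - k) := by simp [hm]
      rw [e1, term_add_sum h1 S (fun j => P ^ (j - i) * Q ^ (k - j)) (Finset.min'_mem S hS), e2,
        term_add_sum h1 S (fun j => P ^ (j - i) * Q ^ (k - j)) (Finset.max'_mem S hS)]
    -- `Σ ≤ T`
    have hge : (∑ j ∈ S, P ^ (j - i) * Q ^ (k - j)) + (P ^ m + Q ^ m) = P ^ m + Q ^ m := by
      rw [← hT]
      refine sum_add_of_forall S _ _ fun j hj => ?_
      obtain ⟨h1j, h2j⟩ := hjS j hj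
      have e : (P + Q) ^ m = (P + Q) ^ (j - i) * (Q + P) ^ (k - j) := by
        rw [add_comm Q P, ← pow_add]; congr 1; omega
      rw [e]
      exact mul_absorb h1 (pow_add_pow_add_eq h1 P Q (j - i)) (pow_add_pow_add_eq h1 Q P (k - j))
    rw [← hge, add_comm, hle]
  rw [hinner, mul_add, add_comm]
  congr 1
  · rw [mul_assoc, ← pow_add]
    congr 2; omega
  · rw [mul_right_comm, ← pow_add]
    congr 2; omega

/-- **Connes–Consani 2016, Lemma 7.5** (as printed, `(compsum)`): "Let `F` be a semifield of
characteristic `1` and `Z ∈ F`, `n ∈ ℕ`. […] For any subset `S ⊂ {0,…,n}` one has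
`∑_S Z^k = Z(i,j)`, `i = inf(S)`, `j = max(S)`", `Z(i,j) := Z^i + Z^j`.
[cite: ConnesConsani2016ArithmeticSite, Lemma 7.5 eq. (66)] -/
theorem ConnesConsani2016_lemma_7_5 {F : Type*} [Semifield F] (h1 : (1 : F) + 1 = 1) (Z : F) {n : ℕ}
    (S : Finset ℕ) (hS : S.Nonempty) (hSn : ∀ j ∈ S, j ≤ n) :
    ∑ j ∈ S, Z ^ j = Z ^ (S.min' hS) + Z ^ (S.max' hS) := by
  have h := ConnesConsani2016_lemma_7_5_homog h1 Z 1 S hS hSn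
  simpa using h

/-- **Connes–Consani 2016, Lemma 7.5** (the span statement): "the additive span of the `Z^i` for
`i ∈ {0,…,n}` is the set of `Z(i,j) := Z^i + Z^j` for `0 ≤ i ≤ j ≤ n`" (additive span = sums over
non-empty subsets, the semifield having no subtraction). [cite: ConnesConsani2016ArithmeticSite, Lemma 7.5] -/
theorem ConnesConsani2016_lemma_7_5_span {F : Type*} [Semifield F] (h1 : (1 : F) + 1 = 1) (Z : F) (n : ℕ) :
    {x : F | ∃ S : Finset ℕ, S.Nonempty ∧ (∀ j ∈ S, j ≤ n) ∧ x = ∑ j ∈ S, Z ^ j} =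
      {x : F | ∃ i j : ℕ, i ≤ j ∧ j ≤ n ∧ x = Z ^ i + Z ^ j} := by
  ext x
  constructor
  · rintro ⟨S, hS, hSn, rfl⟩
    exact ⟨S.min' hS, S.max' hS, Finset.min'_le_max' S hS,
      hSn _ (Finset.max'_mem S hS), ConnesConsani2016_lemma_7_5 h1 Z S hS hSn⟩
  · rintro ⟨i, j, hij, hjn, rfl⟩
    refine ⟨{i, j}, by simp, fun k hk => ?_, ?_⟩
    · simp only [Finset.mem_insert, Finset.mem_singleton] at hk
      rcases hk with rfl | rfl <;> omega
    · by_cases h : i = j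
      · subst h; simp [add_self_of_one_add_one h1]
      · rw [Finset.sum_pair h]

end Lemma75

/-! ## Sums in idempotent semirings (bookkeeping for finite sums of monomials) -/

section IdemSums

variable {M : Type*} [AddCommMonoid M]

/-- In an additively idempotent monoid a sub-sum is absorbed: `∑_B f + ∑_A f = ∑_A f` for `B ⊆ A`.
[cite: ConnesConsani2016ArithmeticSite, Lemma 7.5 (proof: "the repetition … does not affect the sum since `1 + 1 = 1`")] -/
theorem Finset.sum_add_sum_of_subset_idem (hM : ∀ x : M, x + x = x) {ι : Type*} [DecidableEq ι]
    {A B : Finset ι} (h : B ⊆ A) (f : ι → M) : ∑ i ∈ B, f i + ∑ i ∈ A, f i = ∑ i ∈ A, f i := by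
  rw [← Finset.sum_sdiff h, ← add_assoc, add_comm (∑ i ∈ B, f i), add_assoc, hM]

/-- `∑_{A ∪ B} = ∑_A + ∑_B` in an additively idempotent monoid. [cite: ConnesConsani2016ArithmeticSite, Lemma 7.5 (proof: "`1 + 1 = 1`")] -/
theorem Finset.sum_union_idem (hM : ∀ x : M, x + x = x) {ι : Type*} [DecidableEq ι] (A B : Finset ι)
    (f : ι → M) : ∑ i ∈ A ∪ B, f i = ∑ i ∈ A, f i + ∑ i ∈ B, f i := by
  rw [← Finset.sum_union_inter, add_comm (∑ i ∈ A ∪ B, f i),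
    Finset.sum_add_sum_of_subset_idem hM (Finset.inter_subset_union) f]

/-- `∑_{g(A)} f = ∑_A f ∘ g` in an additively idempotent monoid (no injectivity needed).
[cite: ConnesConsani2016ArithmeticSite, Lemma 7.5 (proof of eq. (69): "`1 + 1 = 1`")] -/
theorem Finset.sum_image_idem (hM : ∀ x : M, x + x = x) {α ι : Type*} [DecidableEq ι] (A : Finset α)
    (g : α → ι) (f : ι → M) : ∑ i ∈ A.image g, f i = ∑ a ∈ A, f (g a) := by
  classical
  induction A using Finset.induction_on with
  | empty => simp
  | insert a A ha ih =>
    rw [Finset.image_insert, Finset.sum_insert ha]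
    by_cases hga : g a ∈ A.image g
    · rw [Finset.insert_eq_of_mem hga, ih, ← ih, ← Finset.add_sum_erase _ _ hga, ← add_assoc, hM]
    · rw [Finset.sum_insert hga, ih]

/-- A term of a sum is absorbed by it. [cite: ConnesConsani2016ArithmeticSite, Lemma 7.5 (proof)] -/
theorem Finset.add_sum_idem (hM : ∀ x : M, x + x = x) {ι : Type*} (A : Finset ι) (f : ι → M) {i : ι}
    (hi : i ∈ A) : f i + ∑ j ∈ A, f j = ∑ j ∈ A, f j := by
  classical
  rw [← Finset.add_sum_erase A f hi, ← add_assoc, hM]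

/-- If every term of a sum is absorbed by `b` then so is the sum. [cite: ConnesConsani2016ArithmeticSite, Lemma 7.5 (proof)] -/
theorem Finset.sum_add_eq_of_forall_idem {ι : Type*} (A : Finset ι) (f : ι → M) (b : M)
    (h : ∀ i ∈ A, f i + b = b) : (∑ j ∈ A, f j) + b = b := by
  classical
  induction A using Finset.induction_on with
  | empty => simp
  | insert a A ha ih =>
    rw [Finset.sum_insert ha, add_assoc, ih fun i hi => h i (Finset.mem_insert_of_mem hi),
      h a (Finset.mem_insert_self a A)]

/-- Two-sided absorption pins a sum down: if `b ≤ ∑_A f` (`b + ∑ = ∑`) and every term is `≤ b`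
then `∑_A f = b`. [cite: ConnesConsani2016ArithmeticSite, Lemma 7.5 (proof: "`Z(i,j) = s(i,j)`")] -/
theorem Finset.sum_eq_of_absorb {ι : Type*} (A : Finset ι) (f : ι → M) (b : M)
    (hb : b + ∑ j ∈ A, f j = ∑ j ∈ A, f j) (h : ∀ i ∈ A, f i + b = b) : ∑ j ∈ A, f j = b := by
  rw [← hb, add_comm, Finset.sum_add_eq_of_forall_idem A f b h]

end IdemSums

/-! ## Convexity in characteristic one: `Y^{p+r} = X^r Z^p ⟹ Y ≤ X + Z` -/

/-- In a multiplicatively cancellative semiring of characteristic one, a "geometric mean" is below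
the sum: `Y^{p+r} = X^r Z^p`, `p + r ≠ 0` `⟹ Y + (X + Z) = X + Z`. (The multiplicative content of
Lemma 7.5: the middle powers `Z^x`, `i < x < j`, are absorbed by `Z^i + Z^j`.)
[cite: ConnesConsani2016ArithmeticSite, Lemma 7.5] -/
theorem add_eq_of_pow_eq_mul_pow {R : Type*} [CommSemiring R] [IsCancelMulZero R] (h1 : (1 : R) + 1 = 1)
    {X Y Z : R} {p r : ℕ} (hpr : p + r ≠ 0) (h : Y ^ (p + r) = X ^ r * Z ^ p) : Y + (X + Z) = X + Z := by
  apply pow_left_injective_charOne h1 hpr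
  rw [add_pow_charOne h1, h]
  have hX := pow_add_pow_add_eq h1 X Z r
  have hZ := pow_add_pow_add_eq h1 Z X p
  rw [add_comm Z X] at hZ
  have := mul_absorb h1 hX hZ
  rwa [← pow_add, add_comm r p] at this

/-! ## Constants and the map `δ` of Proposition 7.4 (i) -/

/-- The map underlying the embedding of constants `ℝ₊^max ⊂ 𝒢`. [cite: ConnesConsani2016ArithmeticSite, §7.3 (`q, q^{λ'} ∈ 𝒢`)] -/
def gconstFun (x : 𝕋) : GermExp := ⟨(untrop x).map fun β : ℝ => affG β 0⟩

/-- `q^β ↦ q^{β + 0ε}`. [cite: ConnesConsani2016ArithmeticSite, §7.3] -/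
@[simp] theorem gconstFun_texp (β : ℝ) : gconstFun (texp β) = gaff β 0 := rfl

/-- `0 ↦ 0`. [cite: ConnesConsani2016ArithmeticSite, §7.3] -/
@[simp] theorem gconstFun_zero : gconstFun 0 = 0 := rfl

/-- **Constant germs**: the embedding `ℝ₊^max ↪ 𝒢`, `q^β ↦ q^β` (a semiring morphism).
[cite: ConnesConsani2016ArithmeticSite, §7.3 (`q`, `q^{λ'}` as elements of `𝒢`)] -/
def gconst : 𝕋 →+* GermExp where
  toFun := gconstFun
  map_zero' := rfl
  map_one' := by rw [← texp_zero, gconstFun_texp, gaff_zero]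
  map_mul' x y := by
    rcases eq_zero_or_eq_texp x with rfl | ⟨a, rfl⟩ <;>
      rcases eq_zero_or_eq_texp y with rfl | ⟨b, rfl⟩
    · simp
    · simp
    · simp
    · rw [texp_mul, gconstFun_texp, gconstFun_texp, gconstFun_texp, gaff_mul, add_zero]
  map_add' x y := by
    rcases eq_zero_or_eq_texp x with rfl | ⟨a, rfl⟩ <;>
      rcases eq_zero_or_eq_texp y with rfl | ⟨b, rfl⟩
    · simp
    · simp
    · simp
    · rw [texp_add, gconstFun_texp, gconstFun_texp, gconstFun_texp]
      rcases lt_trichotomy a b with h | rfl | h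
      · rw [min_eq_left h.le, gaff_add_of_lt h]
      · rw [min_self, gaff_add_self]
      · rw [min_eq_right h.le, add_comm, gaff_add_of_lt h]

/-- `gconst (q^β) = q^{β + 0ε}`. [cite: ConnesConsani2016ArithmeticSite, §7.3] -/
@[simp] theorem gconst_texp (β : ℝ) : gconst (texp β) = gaff β 0 := rfl

/-- `gconst 0 = 0`. [cite: ConnesConsani2016ArithmeticSite, §7.3] -/
@[simp] theorem gconst_zero' : gconst 0 = 0 := rfl

/-- The coefficients `(i, j)` of a non-zero `q^{λi + j} ∈ ℛ(λ)` (unique for irrational `λ`).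
[cite: ConnesConsani2016ArithmeticSite, Prop. 7.4 (proof of (i): "Since `λ` is irrational the map `δ` … is an isomorphism with its image")] -/
theorem exists_coeff {l : ℝ} (a : frobSemiring l) (ha : (a : 𝕋) ≠ 0) :
    ∃ nm : ℕ × ℕ, (a : 𝕋) = texp (nm.1 * l + nm.2) := by
  rcases eq_zero_or_eq_rElt a with rfl | ⟨n, m, rfl⟩
  · exact absurd rfl ha
  · exact ⟨(n, m), rfl⟩

/-- A choice of coefficients. [cite: ConnesConsani2016ArithmeticSite, Prop. 7.4 (proof of (i))] -/
def coeff {l : ℝ} (a : frobSemiring l) (ha : (a : 𝕋) ≠ 0) : ℕ × ℕ := (exists_coeff a ha).choose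

/-- The chosen coefficients represent the element. [cite: ConnesConsani2016ArithmeticSite, Prop. 7.4 (proof of (i))] -/
theorem coeff_spec {l : ℝ} (a : frobSemiring l) (ha : (a : 𝕋) ≠ 0) :
    (a : 𝕋) = texp ((coeff a ha).1 * l + (coeff a ha).2) := (exists_coeff a ha).choose_spec

/-- For irrational `λ` the coefficients are determined. [cite: ConnesConsani2016ArithmeticSite, Prop. 7.4 (proof of (i))] -/
theorem coeff_eq {l : ℝ} (hirr : Irrational l) (a : frobSemiring l) (ha : (a : 𝕋) ≠ 0) {n m : ℕ}
    (h : (a : 𝕋) = texp (n * l + m)) : coeff a ha = (n, m) := by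
  have := frobRange_coeff_unique hirr (texp_injective ((coeff_spec a ha).symm.trans h))
  exact Prod.ext this.1 this.2

/-- **The map `Fr_{λ'} ∘ δ` of Proposition 7.4 (i)**: "`δ : ℛ(λ) → 𝒢`,
`δ(q^{λi+j}) := q^{((1+ε)λi)+j}`", composed with `Fr_{λ'}`: `q^{λi+j} ↦ q^{(1+ε)λλ'i + λ'j}`, so that
"`ψ(a,b) = Fr_{λ'}(δ(a)) b`". [cite: ConnesConsani2016ArithmeticSite, Prop. 7.4 (proof of (i))] -/
def epsDelta (l l' : ℝ) (a : frobSemiring l) : GermExp :=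
  if ha : (a : 𝕋) = 0 then 0
  else gaff ((coeff a ha).1 * (l * l') + (coeff a ha).2 * l') ((coeff a ha).1 * (l * l'))

/-- `δ(0) = 0`. [cite: ConnesConsani2016ArithmeticSite, Prop. 7.4 (proof of (i))] -/
theorem epsDelta_zero (l l' : ℝ) : epsDelta l l' 0 = 0 := by
  have h : ((0 : frobSemiring l) : 𝕋) = 0 := rfl
  unfold epsDelta
  exact dif_pos h

/-- `Fr_{λ'}δ(q^{λn+m}) = q^{(1+ε)λλ'n + λ'm}`. [cite: ConnesConsani2016ArithmeticSite, Prop. 7.4 (proof of (i))] -/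
theorem epsDelta_rElt {l : ℝ} (hirr : Irrational l) (l' : ℝ) (n m : ℕ) (h : (n : ℝ) * l + m ∈ frobRange l) :
    epsDelta l l' (rElt l (n * l + m) h) = gaff (n * (l * l') + m * l') (n * (l * l')) := by
  have ha : ((rElt l (n * l + m) h : frobSemiring l) : 𝕋) ≠ 0 := texp_ne_zero _
  unfold epsDelta
  rw [dif_neg ha, coeff_eq hirr _ ha rfl]

/-- `Fr_{λ'}δ` is additive (`λ` irrational, `λ' > 0`): distinct `q^{λi+j}` have distinct values, and
"a strict inequality `λi+j < λi'+j'` […] still holds for `ε` small enough when one replaces `λ` by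
`(1+ε)λ`". [cite: ConnesConsani2016ArithmeticSite, Prop. 7.4 (proof of (i))] -/
theorem epsDelta_add {l l' : ℝ} (hirr : Irrational l) (hl' : 0 < l') (a a' : frobSemiring l) :
    epsDelta l l' (a + a') = epsDelta l l' a + epsDelta l l' a' := by
  rcases eq_zero_or_eq_rElt a with rfl | ⟨n, m, rfl⟩
  · rw [zero_add, epsDelta_zero, zero_add]
  rcases eq_zero_or_eq_rElt a' with rfl | ⟨n', m', rfl⟩
  · rw [add_zero, epsDelta_zero, add_zero]
  rcases lt_trichotomy ((n : ℝ) * l + m) (n' * l + m') with h | h | h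
  · rw [rElt_add _ _ (min_mem_frobRange (mem_frobRange l n m) (mem_frobRange l n' m')),
      rElt_congr _ (mem_frobRange l n m) (min_eq_left h.le), epsDelta_rElt hirr, epsDelta_rElt hirr,
      gaff_add_of_lt]
    calc (n : ℝ) * (l * l') + m * l' = (n * l + m) * l' := by ring
      _ < (n' * l + m') * l' := mul_lt_mul_of_pos_right h hl'
      _ = n' * (l * l') + m' * l' := by ring
  · obtain ⟨rfl, rfl⟩ := frobRange_coeff_unique hirr h
    rw [rElt_add _ _ (min_mem_frobRange (mem_frobRange l n m) (mem_frobRange l n m)),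
      rElt_congr _ (mem_frobRange l n m) (min_self _), epsDelta_rElt hirr, gaff_add_self]
  · rw [rElt_add _ _ (min_mem_frobRange (mem_frobRange l n m) (mem_frobRange l n' m')),
      rElt_congr _ (mem_frobRange l n' m') (min_eq_right h.le), epsDelta_rElt hirr, epsDelta_rElt hirr,
      gaff_add_of_gt]
    calc (n' : ℝ) * (l * l') + m' * l' = (n' * l + m') * l' := by ring
      _ < (n * l + m) * l' := mul_lt_mul_of_pos_right h hl'
      _ = n * (l * l') + m * l' := by ring

/-- `Fr_{λ'}δ` is multiplicative. [cite: ConnesConsani2016ArithmeticSite, Prop. 7.4 (proof of (i))] -/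
theorem epsDelta_mul {l : ℝ} (hirr : Irrational l) (l' : ℝ) (a a' : frobSemiring l) :
    epsDelta l l' (a * a') = epsDelta l l' a * epsDelta l l' a' := by
  rcases eq_zero_or_eq_rElt a with rfl | ⟨n, m, rfl⟩
  · rw [zero_mul, epsDelta_zero, zero_mul]
  rcases eq_zero_or_eq_rElt a' with rfl | ⟨n', m', rfl⟩
  · rw [mul_zero, epsDelta_zero, mul_zero]
  rw [rElt_mul _ _ (add_mem_frobRange (mem_frobRange l n m) (mem_frobRange l n' m')),
    rElt_congr _ (mem_frobRange l (n + n') (m + m')) (by push_cast; ring),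
    epsDelta_rElt hirr, epsDelta_rElt hirr, epsDelta_rElt hirr, gaff_mul]
  push_cast; ring_nf

/-- `Fr_{λ'}δ(1) = 1`. [cite: ConnesConsani2016ArithmeticSite, Prop. 7.4 (proof of (i))] -/
theorem epsDelta_one {l : ℝ} (hirr : Irrational l) (l' : ℝ) : epsDelta l l' 1 = 1 := by
  rw [← rElt_zero l (zero_mem_frobRange l), rElt_congr _ (mem_frobRange l 0 0) (by simp),
    epsDelta_rElt hirr]
  simp

/-- `Fr_{λ'} ∘ δ : ℛ(λ) → 𝒢` as a semiring morphism (`λ` irrational, `λ' > 0`); for `λ' = 1` this is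
`δ` itself, `q^{λi+j} ↦ q^{(1+ε)λi + j}`, whose inverse on its image is "the evaluation at `ε = 0`".
[cite: ConnesConsani2016ArithmeticSite, Prop. 7.4 (proof of (i)) and §7.4 (proof of Thm. 7.7: "the evaluation at `ε = 0` is an isomorphism `R → ℛ(α)`")] -/
def epsDeltaHom {l l' : ℝ} (hirr : Irrational l) (hl' : 0 < l') : frobSemiring l →+* GermExp where
  toFun := epsDelta l l'
  map_zero' := epsDelta_zero l l'
  map_one' := epsDelta_one hirr l'
  map_mul' := epsDelta_mul hirr l'
  map_add' := epsDelta_add hirr hl'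

/-- `Fr_{λ'}δ` as a function. [cite: ConnesConsani2016ArithmeticSite, Prop. 7.4 (proof of (i))] -/
@[simp] theorem epsDeltaHom_apply {l l' : ℝ} (hirr : Irrational l) (hl' : 0 < l') (a : frobSemiring l) :
    epsDeltaHom hirr hl' a = epsDelta l l' a := rfl

/-- `Fr_{λ'} ∘ δ` is injective (`λλ' ≠ 0`): "`δ` … is an isomorphism with its image".
[cite: ConnesConsani2016ArithmeticSite, Prop. 7.4 (proof of (i))] -/
theorem epsDelta_injective {l l' : ℝ} (hirr : Irrational l) (hl : 0 < l) (hl' : 0 < l') :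
    Function.Injective (epsDelta l l') := by
  intro a a' h
  rcases eq_zero_or_eq_rElt a with rfl | ⟨n, m, rfl⟩ <;>
    rcases eq_zero_or_eq_rElt a' with rfl | ⟨n', m', rfl⟩
  · rfl
  · rw [epsDelta_zero, epsDelta_rElt hirr] at h; exact absurd h.symm (gaff_ne_zero _ _)
  · rw [epsDelta_zero, epsDelta_rElt hirr] at h; exact absurd h (gaff_ne_zero _ _)
  · rw [epsDelta_rElt hirr, epsDelta_rElt hirr] at h
    obtain ⟨hv, hs⟩ := gaff_injective h
    have hn : (n : ℝ) = n' := mul_right_cancel₀ (mul_pos hl hl').ne' hs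
    have hm : (m : ℝ) * l' = m' * l' := by rw [hn] at hv; linarith
    have hm' : (m : ℝ) = m' := mul_right_cancel₀ hl'.ne' hm
    exact rElt_congr _ _ (by rw [hn, hm'])

/-! ## Proposition 7.4 (i): `ψ(q^{λi+j}, b) := q^{(1+ε)λλ'i} q^{λ'j} b` -/

/-- `q^{(1+ε)λλ' n + λ'm} · q^{β} ∈ ℛ_ε(λλ', λ')`. [cite: ConnesConsani2016ArithmeticSite, Prop. 7.4 (i)] -/
theorem gaff_mem_epsSemiring (l l' : ℝ) (n m k : ℕ) :
    gaff (n * (l * l') + m * l' + k) (n * (l * l')) ∈ epsSemiring l l' := by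
  have e : gaff (n * (l * l') + m * l' + k) (n * (l * l')) =
      gaff (l * l') (l * l') ^ n * gaff l' 0 ^ m * gaff 1 0 ^ k := by
    rw [gaff_pow, gaff_pow, gaff_pow, gaff_mul, gaff_mul]; ring_nf
  rw [e]
  refine Subsemiring.mul_mem _ (Subsemiring.mul_mem _ (Subsemiring.pow_mem _ ?_ n)
    (Subsemiring.pow_mem _ ?_ m)) (Subsemiring.pow_mem _ ?_ k) <;>
    exact Subsemiring.subset_closure (by simp)

/-- `Fr_{λ'}δ(a) · b ∈ ℛ_ε(λλ',λ')`. [cite: ConnesConsani2016ArithmeticSite, Prop. 7.4 (i)] -/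
theorem epsDelta_mul_gconst_mem {l l' : ℝ} (hirr : Irrational l) (a : frobSemiring l) (b : frobSemiring l') :
    epsDelta l l' a * gconst (b : 𝕋) ∈ epsSemiring l l' := by
  rcases eq_zero_or_eq_rElt a with rfl | ⟨n, m, rfl⟩
  · rw [epsDelta_zero, zero_mul]; exact Subsemiring.zero_mem _
  rcases eq_zero_or_eq_rElt b with rfl | ⟨n', m', rfl⟩
  · rw [Subsemiring.coe_zero, map_zero, mul_zero]; exact Subsemiring.zero_mem _
  rw [epsDelta_rElt hirr, coe_rElt, gconst_texp, gaff_mul, add_zero]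
  have := gaff_mem_epsSemiring l l' n (m + n') m'
  convert this using 2; push_cast; ring

/-- **The map `ψ` of Proposition 7.4 (i)**: "`ψ : ℛ(λ) × ℛ(λ') → ℛ_ε(λλ', λ')`,
`ψ(q^{λi+j}, b) := q^{(1+ε)λλ'i} q^{λ'j} b` `∀ q^{λi+j} ∈ ℛ(λ), b ∈ ℛ(λ')`" (`λ` irrational).
[cite: ConnesConsani2016ArithmeticSite, Prop. 7.4 (i)] -/
def epsPsi (l l' : ℝ) (hirr : Irrational l) (a : frobSemiring l) (b : frobSemiring l') : epsSemiring l l' :=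
  ⟨epsDelta l l' a * gconst (b : 𝕋), epsDelta_mul_gconst_mem hirr a b⟩

/-- `ψ(a,b)` in `𝒢`. [cite: ConnesConsani2016ArithmeticSite, Prop. 7.4 (i)] -/
@[simp] theorem coe_epsPsi {l l' : ℝ} (hirr : Irrational l) (a : frobSemiring l) (b : frobSemiring l') :
    (epsPsi l l' hirr a b : GermExp) = epsDelta l l' a * gconst (b : 𝕋) := rfl

/-- The monomial `q^{(1+ε)λλ'a + β} = q^{(λλ'a + β) + ε λλ'a}` of `ℛ_ε(λλ',λ')`.
[cite: ConnesConsani2016ArithmeticSite, Prop. 7.4 (proof of (ii): `U_ε^a V_ε^b W_ε^c`)] -/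
def epsMono (l l' : ℝ) (t : ℕ × ℝ) : GermExp := gaff (t.1 * (l * l') + t.2) (t.1 * (l * l'))

/-- `ψ(q^{λn+m}, q^β) = q^{(1+ε)λλ'n + λ'm + β}`. [cite: ConnesConsani2016ArithmeticSite, Prop. 7.4 (proof of (i))] -/
theorem coe_epsPsi_rElt {l l' : ℝ} (hirr : Irrational l) (n m : ℕ) {β : ℝ} (hβ : β ∈ frobRange l') :
    (epsPsi l l' hirr (rElt l (n * l + m) (mem_frobRange l n m)) (rElt l' β hβ) : GermExp) =
      epsMono l l' (n, m * l' + β) := by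
  rw [coe_epsPsi, epsDelta_rElt hirr, coe_rElt, gconst_texp, gaff_mul, add_zero, epsMono]
  ring_nf

/-- **Connes–Consani 2016, Proposition 7.4 (i)**: for `λ` irrational, "`ψ` is bilinear,
`ψ(aa', bb') = ψ(a,b)ψ(a',b')` […] and `ψ(r(λ)(x)a, b) = ψ(a, ℓ(λ')(x)b)`" (eq. (63)). (The printed
hypotheses `λ' ∉ ℚ`, `λλ' ∈ ℚλ' + ℚ` are not used for (i).)
[cite: ConnesConsani2016ArithmeticSite, Prop. 7.4 (i)] -/
theorem ConnesConsani2016_prop_7_4_i {l l' : ℝ} (hl : 0 < l) (hl' : 0 < l') (hirr : Irrational l) :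
    IsBalancedBimul (frobCorrespondence l hl) (frobCorrespondence l' hl') (epsPsi l l' hirr) where
  add_left a a' b := Subtype.ext (by
    show epsDelta l l' (a + a') * gconst ((b : frobSemiring l') : 𝕋) =
      epsDelta l l' a * gconst ((b : frobSemiring l') : 𝕋) + epsDelta l l' a' * gconst ((b : frobSemiring l') : 𝕋)
    rw [epsDelta_add hirr hl', add_mul])
  add_right a b b' := Subtype.ext (by
    show epsDelta l l' a * gconst (((b + b' : frobSemiring l')) : 𝕋) =
      epsDelta l l' a * gconst ((b : frobSemiring l') : 𝕋) + epsDelta l l' a * gconst ((b' : frobSemiring l') : 𝕋)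
    rw [Subsemiring.coe_add, map_add, mul_add])
  zero_left b := Subtype.ext (by
    show epsDelta l l' 0 * gconst ((b : frobSemiring l') : 𝕋) = 0
    rw [epsDelta_zero, zero_mul])
  zero_right a := Subtype.ext (by
    show epsDelta l l' a * gconst (((0 : frobSemiring l')) : 𝕋) = 0
    rw [Subsemiring.coe_zero, map_zero, mul_zero])
  mul a a' b b' := Subtype.ext (by
    show epsDelta l l' (a * a') * gconst (((b * b' : frobSemiring l')) : 𝕋) =
      epsDelta l l' a * gconst ((b : frobSemiring l') : 𝕋) * (epsDelta l l' a' * gconst ((b' : frobSemiring l') : 𝕋))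
    rw [Subsemiring.coe_mul, map_mul, epsDelta_mul hirr]; ring)
  one := Subtype.ext (by
    show epsDelta l l' 1 * gconst (((1 : frobSemiring l')) : 𝕋) = 1
    rw [Subsemiring.coe_one, map_one, mul_one, epsDelta_one hirr])
  balanced x a b := Subtype.ext (by
    show epsDelta l l' (frobR l x * a) * gconst ((b : frobSemiring l') : 𝕋) =
      epsDelta l l' a * gconst (((frobEll l' hl' x * b : frobSemiring l')) : 𝕋)
    rw [Subsemiring.coe_mul, map_mul]
    rcases eq_zero_or_eq_nexp x with rfl | ⟨k, rfl⟩
    · rw [map_zero, zero_mul, epsDelta_zero, zero_mul, map_zero, Subsemiring.coe_zero, map_zero,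
        zero_mul, mul_zero]
    rcases eq_zero_or_eq_rElt a with rfl | ⟨n, m, rfl⟩
    · rw [mul_zero, epsDelta_zero, zero_mul, zero_mul]
    rw [frobR_nexp_mul_rElt _ k (add_mem_frobRange (mem_frobRange l n m) (nat_mem_frobRange l k)),
      rElt_congr _ (mem_frobRange l n (m + k)) (by push_cast; ring), epsDelta_rElt hirr,
      epsDelta_rElt hirr, coe_frobEll_nexp, gconst_texp]
    have hassoc : ∀ A G C : GermExp, A * (G * C) = A * G * C := fun A G C => (mul_assoc A G C).symm
    rw [hassoc, gaff_mul]
    congr 2 <;> push_cast <;> ring)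


/-! ## Finite sums of monomials `q^{(λλ'a + β) + ε λλ'a}`: canonical form `m(t₋) + m(t₊)`

"Now assume `F(u) ≠ ∅` […] What remains to be shown is that for any subsets `S, S' ⊂ {0,…,n}` one
has `∑_S Z_ε^j = ∑_{S'} Z_ε^j ⟹ ∑_S Z^j = ∑_{S'} Z^j`. Now `Z_ε` is given by the germ of the function
`ε ↦ q^{mελλ'}` and one gets `∑_S Z_ε^j = ∑_{S'} Z_ε^j ⟺ inf(S) = inf(S')` and `max(S) = max(S')`."
We index monomials by pairs `t = (a, β)` (`a ∈ ℕ` the exponent of `U = φ(q^λ, 1)`, `β ∈ ℕλ' + ℕ`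
collecting `V^b W^c = φ(1, q^{bλ'+c})`), with value `val(t) = λλ'a + β`; a finite sum of monomials
only remembers its least value `u` and, among the monomials of value `u`, the least and the largest
`a` — on the germ side by the displayed equivalence, on the `R` side by Lemma 7.5 (convexity). -/

section CanonicalForm

variable (c : ℝ)

/-- The value `λλ'a + β` of the monomial indexed by `t = (a, β)` (`c = λλ'`).
[cite: ConnesConsani2016ArithmeticSite, Prop. 7.4 (proof of (ii): `F(u)`)] -/
def mval (t : ℕ × ℝ) : ℝ := t.1 * c + t.2

/-- The least value `u` occurring in a finite set of monomials. [cite: ConnesConsani2016ArithmeticSite, Prop. 7.4 (proof of (ii))] -/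
def uMin (S : Finset (ℕ × ℝ)) (hS : S.Nonempty) : ℝ := (S.image (mval c)).min' (hS.image _)

/-- The monomials of least value (`S ∩ F(u)`). [cite: ConnesConsani2016ArithmeticSite, Prop. 7.4 (proof of (ii): `F(u)`)] -/
def level (S : Finset (ℕ × ℝ)) (hS : S.Nonempty) : Finset (ℕ × ℝ) :=
  S.filter fun t => mval c t = uMin c S hS

/-- `u` is the least value. [cite: ConnesConsani2016ArithmeticSite, Prop. 7.4 (proof of (ii))] -/
theorem uMin_le {S : Finset (ℕ × ℝ)} (hS : S.Nonempty) {t : ℕ × ℝ} (ht : t ∈ S) : uMin c S hS ≤ mval c t :=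
  Finset.min'_le _ _ (Finset.mem_image_of_mem _ ht)

/-- Some monomial has the least value. [cite: ConnesConsani2016ArithmeticSite, Prop. 7.4 (proof of (ii): `F(u) ≠ ∅`)] -/
theorem level_nonempty (S : Finset (ℕ × ℝ)) (hS : S.Nonempty) : (level c S hS).Nonempty := by
  obtain ⟨x, hx⟩ := Finset.min'_mem (S.image (mval c)) (hS.image _)
    |> Finset.mem_image.1
  exact ⟨x, Finset.mem_filter.2 ⟨hx.1, hx.2⟩⟩

/-- Membership in the least-value level. [cite: ConnesConsani2016ArithmeticSite, Prop. 7.4 (proof of (ii))] -/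
theorem mem_level {S : Finset (ℕ × ℝ)} {hS : S.Nonempty} {t : ℕ × ℝ} :
    t ∈ level c S hS ↔ t ∈ S ∧ mval c t = uMin c S hS := Finset.mem_filter

/-- The least `a` among the monomials of least value ("`inf(S)`"). [cite: ConnesConsani2016ArithmeticSite, Prop. 7.4 (proof of (ii))] -/
def aMin (S : Finset (ℕ × ℝ)) (hS : S.Nonempty) : ℕ :=
  ((level c S hS).image Prod.fst).min' ((level_nonempty c S hS).image _)

/-- The largest `a` among the monomials of least value ("`max(S)`"). [cite: ConnesConsani2016ArithmeticSite, Prop. 7.4 (proof of (ii))] -/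
def aMax (S : Finset (ℕ × ℝ)) (hS : S.Nonempty) : ℕ :=
  ((level c S hS).image Prod.fst).max' ((level_nonempty c S hS).image _)

/-- The monomial `t₋ = (a₋, u − λλ'a₋)`. [cite: ConnesConsani2016ArithmeticSite, Prop. 7.4 (proof of (ii))] -/
def tMin (S : Finset (ℕ × ℝ)) (hS : S.Nonempty) : ℕ × ℝ :=
  (aMin c S hS, uMin c S hS - aMin c S hS * c)

/-- The monomial `t₊ = (a₊, u − λλ'a₊)`. [cite: ConnesConsani2016ArithmeticSite, Prop. 7.4 (proof of (ii))] -/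
def tMax (S : Finset (ℕ × ℝ)) (hS : S.Nonempty) : ℕ × ℝ :=
  (aMax c S hS, uMin c S hS - aMax c S hS * c)

/-- On `F(u)` the index is determined by `a`: `β = u − λλ'a`. [cite: ConnesConsani2016ArithmeticSite, Prop. 7.4 (proof of (ii): `F(u) = {{(a, u − aα)}}`)] -/
theorem eq_of_mval_eq {t : ℕ × ℝ} {u : ℝ} (h : mval c t = u) : t = (t.1, u - t.1 * c) := by
  ext
  · rfl
  · simp only [mval] at h; simp only; linarith

/-- `t₋` occurs in the sum. [cite: ConnesConsani2016ArithmeticSite, Prop. 7.4 (proof of (ii))] -/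
theorem tMin_mem (S : Finset (ℕ × ℝ)) (hS : S.Nonempty) : tMin c S hS ∈ S := by
  obtain ⟨t, ht, hta⟩ := Finset.mem_image.1
    (Finset.min'_mem ((level c S hS).image Prod.fst) ((level_nonempty c S hS).image _))
  obtain ⟨htS, htv⟩ := (mem_level c).1 ht
  rw [tMin, show aMin c S hS = t.1 from hta.symm]
  rwa [← eq_of_mval_eq c htv]

/-- `t₊` occurs in the sum. [cite: ConnesConsani2016ArithmeticSite, Prop. 7.4 (proof of (ii))] -/
theorem tMax_mem (S : Finset (ℕ × ℝ)) (hS : S.Nonempty) : tMax c S hS ∈ S := by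
  obtain ⟨t, ht, hta⟩ := Finset.mem_image.1
    (Finset.max'_mem ((level c S hS).image Prod.fst) ((level_nonempty c S hS).image _))
  obtain ⟨htS, htv⟩ := (mem_level c).1 ht
  rw [tMax, show aMax c S hS = t.1 from hta.symm]
  rwa [← eq_of_mval_eq c htv]

/-- `t₋` has the least value. [cite: ConnesConsani2016ArithmeticSite, Prop. 7.4 (proof of (ii))] -/
@[simp] theorem mval_tMin (S : Finset (ℕ × ℝ)) (hS : S.Nonempty) : mval c (tMin c S hS) = uMin c S hS := by
  simp [mval, tMin]

/-- `t₊` has the least value. [cite: ConnesConsani2016ArithmeticSite, Prop. 7.4 (proof of (ii))] -/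
@[simp] theorem mval_tMax (S : Finset (ℕ × ℝ)) (hS : S.Nonempty) : mval c (tMax c S hS) = uMin c S hS := by
  simp [mval, tMax]

/-- `a₋ ≤ a ≤ a₊` on the least-value level. [cite: ConnesConsani2016ArithmeticSite, Prop. 7.4 (proof of (ii))] -/
theorem aMin_le {S : Finset (ℕ × ℝ)} (hS : S.Nonempty) {t : ℕ × ℝ} (ht : t ∈ S) (hv : mval c t = uMin c S hS) :
    aMin c S hS ≤ t.1 ∧ t.1 ≤ aMax c S hS :=
  ⟨Finset.min'_le _ _ (Finset.mem_image_of_mem _ ((mem_level c).2 ⟨ht, hv⟩)),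
    Finset.le_max' _ _ (Finset.mem_image_of_mem _ ((mem_level c).2 ⟨ht, hv⟩))⟩

/-- `a₋ ≤ a₊`. [cite: ConnesConsani2016ArithmeticSite, Prop. 7.4 (proof of (ii))] -/
theorem aMin_le_aMax (S : Finset (ℕ × ℝ)) (hS : S.Nonempty) : aMin c S hS ≤ aMax c S hS :=
  (aMin_le c hS (tMin_mem c S hS) (mval_tMin c S hS)).2

/-- **Canonical form of a finite sum of monomials** under two absorption rules (valid both for the
germs `U_ε^a V_ε^b W_ε^c` and, by (60) and Lemma 7.5, for `U^a V^b W^c ∈ R`): the sum equals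
`m(t₋) + m(t₊)`. [cite: ConnesConsani2016ArithmeticSite, Prop. 7.4 (proof of (ii))] -/
theorem sum_eq_two_of_absorb {M : Type*} [AddCommMonoid M] (hM : ∀ x : M, x + x = x)
    (P : ℕ × ℝ → Prop) (m : ℕ × ℝ → M)
    (hlt : ∀ t t', P t → P t' → mval c t < mval c t' → m t + m t' = m t)
    (hmid : ∀ t t₁ t₂, P t → P t₁ → P t₂ → mval c t₁ = mval c t → mval c t₂ = mval c t →
      t₁.1 ≤ t.1 → t.1 ≤ t₂.1 → m t + (m t₁ + m t₂) = m t₁ + m t₂)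
    (S : Finset (ℕ × ℝ)) (hS : S.Nonempty) (hP : ∀ t ∈ S, P t) :
    ∑ t ∈ S, m t = m (tMin c S hS) + m (tMax c S hS) := by
  refine Finset.sum_eq_of_absorb S m _ ?_ fun t ht => ?_
  · rw [add_assoc, Finset.add_sum_idem hM S m (tMax_mem c S hS), Finset.add_sum_idem hM S m (tMin_mem c S hS)]
  · rcases (uMin_le c hS ht).eq_or_lt with hv | hv
    · obtain ⟨h1, h2⟩ := aMin_le c hS ht hv.symm
      exact hmid t _ _ (hP t ht) (hP _ (tMin_mem c S hS)) (hP _ (tMax_mem c S hS))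
        (by rw [mval_tMin, hv]) (by rw [mval_tMax, hv]) h1 h2
    · have h := hlt _ _ (hP _ (tMin_mem c S hS)) (hP t ht) (by rwa [mval_tMin])
      calc m t + (m (tMin c S hS) + m (tMax c S hS))
          = (m (tMin c S hS) + m t) + m (tMax c S hS) := by rw [add_comm (m (tMin c S hS)) (m t), add_assoc]
        _ = m (tMin c S hS) + m (tMax c S hS) := by rw [h]

end CanonicalForm

/-! ### The germ side: `∑_S q^{(1+ε)λλ'a + β}` determines and is determined by `(u, a₋, a₊)` -/

/-- A middle slope is absorbed: for `p ≤ s ≤ r`, `min(u+εs, u+εp, u+εr) = min(u+εp, u+εr)` for all `ε`.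
[cite: ConnesConsani2016ArithmeticSite, Prop. 7.4 (proof of (ii): "`∑_S Z_ε^j = ∑_{S'} Z_ε^j ⟺ inf(S) = inf(S')` and `max(S) = max(S')`")] -/
theorem gaff_mid_absorb {u p s r : ℝ} (h1 : p ≤ s) (h2 : s ≤ r) :
    gaff u s + (gaff u p + gaff u r) = gaff u p + gaff u r := by
  unfold gaff
  rw [gexp_add, gexp_add]
  congr 1
  show (((fun ε : ℝ => (u + s * ε) ⊓ ((u + p * ε) ⊓ (u + r * ε))) : ℝ → ℝ) : EGerm) =
    (((fun ε : ℝ => (u + p * ε) ⊓ (u + r * ε)) : ℝ → ℝ) : EGerm)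
  congr 1
  funext ε
  refine min_eq_right ?_
  rcases le_or_gt 0 ε with hε | hε
  · exact le_trans (min_le_left _ _) (by nlinarith)
  · exact le_trans (min_le_right _ _) (by nlinarith)

/-- Germs `min(u + εp, u + εr)` (`p ≤ r`) remember `u`, `p` and `r`.
[cite: ConnesConsani2016ArithmeticSite, Prop. 7.4 (proof of (ii))] -/
theorem gaff_two_inj {u p r u' p' r' : ℝ} (hpr : p ≤ r) (hpr' : p' ≤ r')
    (h : gaff u p + gaff u r = gaff u' p' + gaff u' r') : u = u' ∧ p = p' ∧ r = r' := by
  unfold gaff at h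
  rw [gexp_add, gexp_add] at h
  have h1 : affG u p ⊓ affG u r = affG u' p' ⊓ affG u' r' := gexp_injective h
  have h2 : (fun ε : ℝ => (u + p * ε) ⊓ (u + r * ε)) =ᶠ[𝓝 0] fun ε : ℝ => (u' + p' * ε) ⊓ (u' + r' * ε) :=
    Germ.coe_eq.1 h1
  have hu : u = u' := by simpa using h2.eq_of_nhds
  subst hu
  obtain ⟨δ, hδ, hball⟩ := Metric.eventually_nhds_iff.1 h2
  have hpos : dist (δ / 2) (0 : ℝ) < δ := by
    rw [Real.dist_eq, sub_zero, abs_of_pos (by positivity)]; linarith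
  have hneg : dist (-(δ / 2)) (0 : ℝ) < δ := by
    rw [Real.dist_eq, sub_zero, abs_neg, abs_of_pos (by positivity)]; linarith
  have e1 := hball hpos
  have e2 := hball hneg
  simp only at e1 e2
  rw [min_eq_left (by nlinarith), min_eq_left (by nlinarith)] at e1
  rw [min_eq_right (by nlinarith), min_eq_right (by nlinarith)] at e2
  have hδ2 : (δ / 2 : ℝ) ≠ 0 := by positivity
  refine ⟨rfl, ?_, ?_⟩
  · exact mul_right_cancel₀ hδ2 (by linarith)
  · have hδ2' : (-(δ / 2) : ℝ) ≠ 0 := by intro h0; apply hδ2; linarith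
    exact mul_right_cancel₀ hδ2' (by linarith)

/-- `epsMono` through the value. [cite: ConnesConsani2016ArithmeticSite, Prop. 7.4 (proof of (ii))] -/
theorem epsMono_eq (l l' : ℝ) (t : ℕ × ℝ) : epsMono l l' t = gaff (mval (l * l') t) (t.1 * (l * l')) := rfl

/-- The germ `∑_{t∈S} q^{(1+ε)λλ'a_t + β_t}` in canonical form.
[cite: ConnesConsani2016ArithmeticSite, Prop. 7.4 (proof of (ii))] -/
theorem epsSum_eq_two {l l' : ℝ} (hc : 0 < l * l') (S : Finset (ℕ × ℝ)) (hS : S.Nonempty) :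
    ∑ t ∈ S, epsMono l l' t =
      gaff (uMin (l * l') S hS) (aMin (l * l') S hS * (l * l')) +
        gaff (uMin (l * l') S hS) (aMax (l * l') S hS * (l * l')) := by
  have h := sum_eq_two_of_absorb (l * l') (M := GermExp) (fun x => add_self_of_one_add_one GermExp.one_add_one x)
    (fun _ => True) (epsMono l l')
    (fun t t' _ _ hlt => by rw [epsMono_eq, epsMono_eq, gaff_add_of_lt hlt])
    (fun t t₁ t₂ _ _ _ hv1 hv2 h1 h2 => by
      rw [epsMono_eq, epsMono_eq, epsMono_eq, hv1, hv2]
      exact gaff_mid_absorb (mul_le_mul_of_nonneg_right (Nat.cast_le.2 h1) hc.le)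
        (mul_le_mul_of_nonneg_right (Nat.cast_le.2 h2) hc.le))
    S hS (fun _ _ => trivial)
  rw [h, epsMono_eq, epsMono_eq, mval_tMin, mval_tMax]
  rfl

/-- **"`∑_S Z_ε^j = ∑_{S'} Z_ε^j ⟺ inf(S) = inf(S')` and `max(S) = max(S')`"**: equal sums of
monomial germs have the same `(u, a₋, a₊)`. [cite: ConnesConsani2016ArithmeticSite, Prop. 7.4 (proof of (ii))] -/
theorem epsSum_inj {l l' : ℝ} (hc : 0 < l * l') {S S' : Finset (ℕ × ℝ)} (hS : S.Nonempty)
    (hS' : S'.Nonempty) (h : ∑ t ∈ S, epsMono l l' t = ∑ t ∈ S', epsMono l l' t) :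
    uMin (l * l') S hS = uMin (l * l') S' hS' ∧ aMin (l * l') S hS = aMin (l * l') S' hS' ∧
      aMax (l * l') S hS = aMax (l * l') S' hS' := by
  rw [epsSum_eq_two hc S hS, epsSum_eq_two hc S' hS'] at h
  obtain ⟨hu, hp, hr⟩ := gaff_two_inj
    (mul_le_mul_of_nonneg_right (Nat.cast_le.2 (aMin_le_aMax _ S hS)) hc.le)
    (mul_le_mul_of_nonneg_right (Nat.cast_le.2 (aMin_le_aMax _ S' hS')) hc.le) h
  refine ⟨hu, ?_, ?_⟩
  · exact_mod_cast mul_right_cancel₀ hc.ne' hp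
  · exact_mod_cast mul_right_cancel₀ hc.ne' hr

/-- Equal sums of monomial germs have the same `t₋`, `t₊`. [cite: ConnesConsani2016ArithmeticSite, Prop. 7.4 (proof of (ii))] -/
theorem tMin_eq_of_epsSum_eq {l l' : ℝ} (hc : 0 < l * l') {S S' : Finset (ℕ × ℝ)} (hS : S.Nonempty)
    (hS' : S'.Nonempty) (h : ∑ t ∈ S, epsMono l l' t = ∑ t ∈ S', epsMono l l' t) :
    tMin (l * l') S hS = tMin (l * l') S' hS' ∧ tMax (l * l') S hS = tMax (l * l') S' hS' := by
  obtain ⟨hu, hp, hr⟩ := epsSum_inj hc hS hS' h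
  simp only [tMin, tMax, hu, hp, hr, and_self]


/-! ## Proposition 7.4 (ii): the universal property of `(ℛ_ε(λλ',λ'), ψ)` -/

/-- Monomial germs multiply by adding indices. [cite: ConnesConsani2016ArithmeticSite, Prop. 7.4 (proof of (ii))] -/
theorem epsMono_add (l l' : ℝ) (t t' : ℕ × ℝ) :
    epsMono l l' (t + t') = epsMono l l' t * epsMono l l' t' := by
  simp only [epsMono, Prod.fst_add, Prod.snd_add, gaff_mul, Nat.cast_add]
  congr 1 <;> ring

/-- Sums of monomial germs are never the zero germ. [cite: ConnesConsani2016ArithmeticSite, Prop. 7.4 (proof of (ii))] -/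
theorem epsSum_ne_zero {l l' : ℝ} (hc : 0 < l * l') (S : Finset (ℕ × ℝ)) (hS : S.Nonempty) :
    ∑ t ∈ S, epsMono l l' t ≠ 0 := by
  rw [epsSum_eq_two hc S hS, gaff, gaff, gexp_add]
  exact gexp_ne_zero _

/-- **Every element of `ℛ_ε(λλ',λ')` is a finite sum of monomials** `q^{(1+ε)λλ'a + bλ' + c}`
("Its elements are finite sums of the form `σ(ε) = ∑ q^{(1+ε)αn_j + m_j}`").
[cite: ConnesConsani2016ArithmeticSite, §7.4 (proof of Thm. 7.7) and Prop. 7.4 (proof of (ii))] -/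
theorem exists_epsSum {l l' : ℝ} {x : GermExp} (hx : x ∈ epsSemiring l l') :
    x = 0 ∨ ∃ S : Finset (ℕ × ℝ), S.Nonempty ∧ (∀ t ∈ S, t.2 ∈ frobRange l') ∧
      x = ∑ t ∈ S, epsMono l l' t := by
  classical
  induction hx using Subsemiring.closure_induction with
  | mem g hg =>
    simp only [Set.mem_insert_iff, Set.mem_singleton_iff] at hg
    right
    rcases hg with rfl | rfl | rfl
    · refine ⟨{((0 : ℕ), (1 : ℝ))}, by simp, fun t ht => ?_, ?_⟩
      · simp only [Finset.mem_singleton] at ht; subst ht; simpa using nat_mem_frobRange l' 1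
      · simp [epsMono]
    · refine ⟨{((0 : ℕ), l')}, by simp, fun t ht => ?_, ?_⟩
      · simp only [Finset.mem_singleton] at ht; subst ht; exact self_mem_frobRange l'
      · simp [epsMono]
    · refine ⟨{((1 : ℕ), (0 : ℝ))}, by simp, fun t ht => ?_, ?_⟩
      · simp only [Finset.mem_singleton] at ht; subst ht; exact zero_mem_frobRange l'
      · simp [epsMono]
  | zero => exact Or.inl rfl
  | one =>
    refine Or.inr ⟨{((0 : ℕ), (0 : ℝ))}, by simp, fun t ht => ?_, ?_⟩
    · simp only [Finset.mem_singleton] at ht; subst ht; exact zero_mem_frobRange l'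
    · simp [epsMono]
  | add x y _ _ ihx ihy =>
    rcases ihx with rfl | ⟨S, hS, hSa, rfl⟩
    · rw [zero_add]; exact ihy
    rcases ihy with rfl | ⟨S', hS', hS'a, rfl⟩
    · rw [add_zero]; exact Or.inr ⟨S, hS, hSa, rfl⟩
    refine Or.inr ⟨S ∪ S', hS.mono Finset.subset_union_left, fun t ht => ?_, ?_⟩
    · rcases Finset.mem_union.1 ht with h | h
      · exact hSa t h
      · exact hS'a t h
    · rw [Finset.sum_union_idem (fun x => add_self_of_one_add_one GermExp.one_add_one x)]
  | mul x y _ _ ihx ihy =>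
    rcases ihx with rfl | ⟨S, hS, hSa, rfl⟩
    · rw [zero_mul]; exact Or.inl rfl
    rcases ihy with rfl | ⟨S', hS', hS'a, rfl⟩
    · rw [mul_zero]; exact Or.inl rfl
    refine Or.inr ⟨(S ×ˢ S').image fun p => p.1 + p.2, (hS.product hS').image _, fun t ht => ?_, ?_⟩
    · obtain ⟨p, hp, rfl⟩ := Finset.mem_image.1 ht
      obtain ⟨h1, h2⟩ := Finset.mem_product.1 hp
      simpa using add_mem_frobRange (hSa _ h1) (hS'a _ h2)
    · rw [Finset.sum_image_idem (fun x => add_self_of_one_add_one GermExp.one_add_one x),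
        Finset.sum_mul_sum, ← Finset.sum_product']
      exact Finset.sum_congr rfl fun p _ => (epsMono_add l l' p.1 p.2).symm

section RhoGeneric

/-! ### From a monomial valuation on `R` obeying the two absorption rules to `ρ : ℛ_ε(λλ',λ') → R`
(the common skeleton of the proofs of Prop. 7.4 (ii) and Lemma 7.8 (ii)). -/

variable {l l' : ℝ} {R : Type} [CommSemiring R] (rM : ℕ × ℝ → R)

/-- The rules satisfied by the `R`-side monomials `t = (a, β) ↦ U^a V^b W^c` in the proofs of
Prop. 7.4 (ii) and Lemma 7.8 (ii): characteristic one, the addition rule (60)/(73) ("smaller value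
absorbs"), absorption of middle monomials of equal value (Lemma 7.5), multiplicativity, unit.
[cite: ConnesConsani2016ArithmeticSite, Prop. 7.4 (proof of (ii)) and Lemma 7.8 (proof of (ii))] -/
structure MonoRules (l l' : ℝ) {R : Type} [CommSemiring R] (rM : ℕ × ℝ → R) : Prop where
  one_add_one : (1 : R) + 1 = 1
  lt : ∀ t t' : ℕ × ℝ, t.2 ∈ frobRange l' → t'.2 ∈ frobRange l' →
    mval (l * l') t < mval (l * l') t' → rM t + rM t' = rM t
  mid : ∀ t t₁ t₂ : ℕ × ℝ, t.2 ∈ frobRange l' → t₁.2 ∈ frobRange l' → t₂.2 ∈ frobRange l' →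
    mval (l * l') t₁ = mval (l * l') t → mval (l * l') t₂ = mval (l * l') t → t₁.1 ≤ t.1 → t.1 ≤ t₂.1 →
    rM t + (rM t₁ + rM t₂) = rM t₁ + rM t₂
  add : ∀ t t' : ℕ × ℝ, t.2 ∈ frobRange l' → t'.2 ∈ frobRange l' → rM (t + t') = rM t * rM t'
  zero : rM ((0 : ℕ), (0 : ℝ)) = 1

open Classical in
/-- The map `ρ` on `ℛ_ε(λλ',λ')` attached to a monomial valuation: `0 ↦ 0`,
`∑_S U_ε^aV_ε^bW_ε^c ↦ ∑_S U^aV^bW^c`. [cite: ConnesConsani2016ArithmeticSite, Prop. 7.4 (proof of (ii))] -/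
def rhoGFun (x : epsSemiring l l') : R :=
  if h : ∃ S : Finset (ℕ × ℝ), S.Nonempty ∧ (∀ t ∈ S, t.2 ∈ frobRange l') ∧
      (x : GermExp) = ∑ t ∈ S, epsMono l l' t
  then ∑ t ∈ h.choose, rM t else 0

/-- `ρ(0) = 0`. [cite: ConnesConsani2016ArithmeticSite, Prop. 7.4 (proof of (ii))] -/
theorem rhoGFun_zero (hc : 0 < l * l') : rhoGFun rM (0 : epsSemiring l l') = 0 := by
  unfold rhoGFun
  rw [dif_neg]
  rintro ⟨S, hS, -, h⟩
  exact epsSum_ne_zero hc S hS (h.symm.trans rfl)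

variable {rM} (hr : MonoRules l l' rM) (hc : 0 < l * l')
include hr hc

omit hc in
/-- The `R`-side sum in canonical form. [cite: ConnesConsani2016ArithmeticSite, Prop. 7.4 (proof of (ii))] -/
theorem rSum_eq_two (S : Finset (ℕ × ℝ)) (hS : S.Nonempty) (hA : ∀ t ∈ S, t.2 ∈ frobRange l') :
    ∑ t ∈ S, rM t = rM (tMin (l * l') S hS) + rM (tMax (l * l') S hS) :=
  sum_eq_two_of_absorb (l * l') (fun x => add_self_of_one_add_one hr.one_add_one x)
    (fun t => t.2 ∈ frobRange l') rM hr.lt hr.mid S hS hA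

/-- **Well-definedness of `ρ`**: "`∑_S U_ε^a V_ε^b W_ε^c = ∑_{S'} U_ε^a V_ε^b W_ε^c ⟹
∑_S U^a V^b W^c = ∑_{S'} U^a V^b W^c`". [cite: ConnesConsani2016ArithmeticSite, Prop. 7.4 (proof of (ii))] -/
theorem rSum_eq_of_epsSum_eq {S S' : Finset (ℕ × ℝ)} (hS : S.Nonempty) (hS' : S'.Nonempty)
    (hA : ∀ t ∈ S, t.2 ∈ frobRange l') (hA' : ∀ t ∈ S', t.2 ∈ frobRange l')
    (h : ∑ t ∈ S, epsMono l l' t = ∑ t ∈ S', epsMono l l' t) :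
    ∑ t ∈ S, rM t = ∑ t ∈ S', rM t := by
  obtain ⟨h1, h2⟩ := tMin_eq_of_epsSum_eq hc hS hS' h
  rw [rSum_eq_two hr S hS hA, rSum_eq_two hr S' hS' hA', h1, h2]

/-- `ρ(∑_S U_ε^aV_ε^bW_ε^c) = ∑_S U^aV^bW^c` for every admissible `S`. [cite: ConnesConsani2016ArithmeticSite, Prop. 7.4 (proof of (ii))] -/
theorem rhoGFun_epsSum (S : Finset (ℕ × ℝ)) (hS : S.Nonempty) (hA : ∀ t ∈ S, t.2 ∈ frobRange l')
    (x : epsSemiring l l') (hx : (x : GermExp) = ∑ t ∈ S, epsMono l l' t) :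
    rhoGFun rM x = ∑ t ∈ S, rM t := by
  have h : ∃ S : Finset (ℕ × ℝ), S.Nonempty ∧ (∀ t ∈ S, t.2 ∈ frobRange l') ∧
      (x : GermExp) = ∑ t ∈ S, epsMono l l' t := ⟨S, hS, hA, hx⟩
  unfold rhoGFun
  rw [dif_pos h]
  exact rSum_eq_of_epsSum_eq hr hc h.choose_spec.1 hS h.choose_spec.2.1 hA (h.choose_spec.2.2.symm.trans hx)

/-- **The homomorphism `ρ : ℛ_ε(λλ',λ') → R`** attached to a monomial valuation ("if one defines `ρ`
on monomials using multiplicativity […], the additivity follows provided one proves that […]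
`∑_S U_ε^aV_ε^bW_ε^c = ∑_{S'} U_ε^aV_ε^bW_ε^c ⟹ ∑_S U^aV^bW^c = ∑_{S'} U^aV^bW^c`").
[cite: ConnesConsani2016ArithmeticSite, Prop. 7.4 (proof of (ii))] -/
def rhoGHom : epsSemiring l l' →+* R where
  toFun := rhoGFun rM
  map_zero' := rhoGFun_zero rM hc
  map_one' := by
    rw [rhoGFun_epsSum hr hc {((0 : ℕ), (0 : ℝ))} (by simp)
      (fun t ht => by simp only [Finset.mem_singleton] at ht; subst ht; exact zero_mem_frobRange l') 1
      (by simp [epsMono])]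
    rw [Finset.sum_singleton, hr.zero]
  map_mul' x y := by
    classical
    rcases exists_epsSum x.2 with hx | ⟨S, hS, hSa, hx⟩
    · rw [show x = 0 from Subtype.ext hx, zero_mul, rhoGFun_zero rM hc, zero_mul]
    rcases exists_epsSum y.2 with hy | ⟨S', hS', hS'a, hy⟩
    · rw [show y = 0 from Subtype.ext hy, mul_zero, rhoGFun_zero rM hc, mul_zero]
    have hxy : ((x * y : epsSemiring l l') : GermExp) =
        ∑ t ∈ (S ×ˢ S').image (fun p => p.1 + p.2), epsMono l l' t := by
      rw [Subsemiring.coe_mul, hx, hy,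
        Finset.sum_image_idem (fun x => add_self_of_one_add_one GermExp.one_add_one x),
        Finset.sum_mul_sum, ← Finset.sum_product']
      exact Finset.sum_congr rfl fun p _ => (epsMono_add l l' p.1 p.2).symm
    rw [rhoGFun_epsSum hr hc S hS hSa x hx, rhoGFun_epsSum hr hc S' hS' hS'a y hy,
      rhoGFun_epsSum hr hc _ ((hS.product hS').image _) (fun t ht => by
        obtain ⟨p, hp, rfl⟩ := Finset.mem_image.1 ht
        obtain ⟨h1, h2⟩ := Finset.mem_product.1 hp
        simpa using add_mem_frobRange (hSa _ h1) (hS'a _ h2)) _ hxy,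
      Finset.sum_image_idem (fun x => add_self_of_one_add_one hr.one_add_one x), Finset.sum_mul_sum,
      ← Finset.sum_product']
    refine Finset.sum_congr rfl fun p hp => ?_
    obtain ⟨h1, h2⟩ := Finset.mem_product.1 hp
    exact hr.add _ _ (hSa _ h1) (hS'a _ h2)
  map_add' x y := by
    classical
    rcases exists_epsSum x.2 with hx | ⟨S, hS, hSa, hx⟩
    · rw [show x = 0 from Subtype.ext hx, zero_add, rhoGFun_zero rM hc, zero_add]
    rcases exists_epsSum y.2 with hy | ⟨S', hS', hS'a, hy⟩
    · rw [show y = 0 from Subtype.ext hy, add_zero, rhoGFun_zero rM hc, add_zero]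
    have hxy : ((x + y : epsSemiring l l') : GermExp) = ∑ t ∈ S ∪ S', epsMono l l' t := by
      rw [Subsemiring.coe_add, hx, hy, Finset.sum_union_idem (fun x => add_self_of_one_add_one GermExp.one_add_one x)]
    rw [rhoGFun_epsSum hr hc S hS hSa x hx, rhoGFun_epsSum hr hc S' hS' hS'a y hy,
      rhoGFun_epsSum hr hc _ (hS.mono Finset.subset_union_left) (fun t ht => by
        rcases Finset.mem_union.1 ht with h | h
        · exact hSa t h
        · exact hS'a t h) _ hxy,
      Finset.sum_union_idem (fun x => add_self_of_one_add_one hr.one_add_one x)]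

/-- `ρ` as a function. [cite: ConnesConsani2016ArithmeticSite, Prop. 7.4 (proof of (ii))] -/
theorem rhoGHom_apply (x : epsSemiring l l') : rhoGHom hr hc x = rhoGFun rM x := rfl

/-- `ρ` on a single monomial. [cite: ConnesConsani2016ArithmeticSite, Prop. 7.4 (proof of (ii))] -/
theorem rhoGHom_epsMono (t : ℕ × ℝ) (ht : t.2 ∈ frobRange l') (x : epsSemiring l l')
    (hx : (x : GermExp) = epsMono l l' t) : rhoGHom hr hc x = rM t := by
  rw [rhoGHom_apply, rhoGFun_epsSum hr hc {t} (by simp)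
    (fun t' ht' => by simp only [Finset.mem_singleton] at ht'; subst ht'; exact ht) x
    (by rw [Finset.sum_singleton, hx]), Finset.sum_singleton]

end RhoGeneric

section Prop74

variable {l l' : ℝ} (hl : 0 < l) (hl' : 0 < l') {R : Type} [CommSemiring R]
  (φ : frobSemiring l → frobSemiring l' → R)

open Classical in
/-- The `R`-side monomial `U^a V^b W^c = φ(q^{aλ}, q^β)`, `β = bλ' + c` ("The products `V^b W^c`
only depend on `β`"). [cite: ConnesConsani2016ArithmeticSite, Prop. 7.4 (proof of (ii)) and §7.4 (proof of Lemma 7.8 (ii))] -/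
def rMono (t : ℕ × ℝ) : R :=
  if h : t.2 ∈ frobRange l' then Phi φ t.1 t.2 h else 0

/-- `rMono` on an admissible index. [cite: ConnesConsani2016ArithmeticSite, Prop. 7.4 (proof of (ii))] -/
theorem rMono_eq {t : ℕ × ℝ} (h : t.2 ∈ frobRange l') : rMono φ t = Phi φ t.1 t.2 h := dif_pos h

variable (hφ : IsBalancedBimul (frobCorrespondence l hl) (frobCorrespondence l' hl') φ)
include hφ

/-- `rMono (0,0) = φ(1,1) = 1`. [cite: ConnesConsani2016ArithmeticSite, Prop. 7.4 (proof of (ii))] -/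
theorem rMono_zero_zero : rMono φ ((0 : ℕ), (0 : ℝ)) = 1 := by
  rw [rMono_eq φ (zero_mem_frobRange l')]
  show φ _ _ = 1
  rw [rElt_congr _ (zero_mem_frobRange l) (by simp), rElt_zero, rElt_zero, hφ.one']

/-- Monomials of `R` multiply by adding indices. [cite: ConnesConsani2016ArithmeticSite, Prop. 7.4 (proof of (ii): "define `ρ` on monomials using multiplicativity")] -/
theorem rMono_add {t t' : ℕ × ℝ} (ht : t.2 ∈ frobRange l') (ht' : t'.2 ∈ frobRange l') :
    rMono φ (t + t') = rMono φ t * rMono φ t' := by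
  rw [rMono_eq φ ht, rMono_eq φ ht', rMono_eq φ (by simpa using add_mem_frobRange ht ht')]
  unfold Phi
  rw [← hφ.mul_rElt (nat_mul_mem_frobRange l t.1) (nat_mul_mem_frobRange l t'.1) ht ht'
    (add_mem_frobRange (nat_mul_mem_frobRange l t.1) (nat_mul_mem_frobRange l t'.1)) (add_mem_frobRange ht ht')]
  congr 1
  exact rElt_congr _ _ (by simp only [Prod.fst_add]; push_cast; ring)

variable [IsCancelMulZero R]

/-- **The addition rule (60) for monomials of `R`**: smaller value absorbs ("As shown in the proof of
Proposition 7.3, one has the addition rule (60) which means with our notations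
`λλ'a + λ'b + c < λλ'a' + λ'b' + c' ⟹ U^aV^bW^c + U^{a'}V^{b'}W^{c'} = U^aV^bW^c`").
[cite: ConnesConsani2016ArithmeticSite, Prop. 7.4 (proof of (ii))] -/
theorem rMono_lt {t t' : ℕ × ℝ} (ht : t.2 ∈ frobRange l') (ht' : t'.2 ∈ frobRange l')
    (hlt : mval (l * l') t < mval (l * l') t') : rMono φ t + rMono φ t' = rMono φ t := by
  rw [rMono_eq φ ht, rMono_eq φ ht']
  unfold Phi
  refine ConnesConsani2016_prop_7_3_addRule hl hl' hφ _ _ ht ht' ?_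
  simp only [mval] at hlt
  linarith [hlt]

/-- **Middle monomials are absorbed** (the role of Lemma 7.5): for three monomials of the same value
with `a₁ ≤ a ≤ a₂`, `M + (M₁ + M₂) = M₁ + M₂`, because `M^{a₂−a₁} = M₁^{a₂−a} M₂^{a−a₁}` exactly.
[cite: ConnesConsani2016ArithmeticSite, Prop. 7.4 (proof of (ii): "Thus the proof of (ii) follows from Lemma 7.5")] -/
theorem rMono_mid {t t₁ t₂ : ℕ × ℝ} (ht : t.2 ∈ frobRange l') (ht₁ : t₁.2 ∈ frobRange l')
    (ht₂ : t₂.2 ∈ frobRange l') (hv₁ : mval (l * l') t₁ = mval (l * l') t)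
    (hv₂ : mval (l * l') t₂ = mval (l * l') t) (h₁ : t₁.1 ≤ t.1) (h₂ : t.1 ≤ t₂.1) :
    rMono φ t + (rMono φ t₁ + rMono φ t₂) = rMono φ t₁ + rMono φ t₂ := by
  have h1R : (1 : R) + 1 = 1 := hφ.one_add_one
  rcases h₁.eq_or_lt with e₁ | lt₁
  · -- `t = t₁`
    have : t₁ = t := by
      obtain ⟨a₁, b₁⟩ := t₁
      obtain ⟨a, b⟩ := t
      simp only [mval] at hv₁
      simp only at e₁
      subst e₁
      simp only [Prod.mk.injEq, true_and]
      linarith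
    rw [this, ← add_assoc, add_self_of_one_add_one h1R]
  rcases h₂.eq_or_lt with e₂ | lt₂
  · have : t₂ = t := by
      obtain ⟨a₂, b₂⟩ := t₂
      obtain ⟨a, b⟩ := t
      simp only [mval] at hv₂
      simp only at e₂
      subst e₂
      simp only [Prod.mk.injEq, true_and]
      linarith
    rw [this, add_comm (rMono φ t₁), ← add_assoc, add_self_of_one_add_one h1R]
  -- strict case: convexity
  set p := t.1 - t₁.1 with hp
  set r := t₂.1 - t.1 with hr
  have hp0 : 0 < p := by omega
  have hpr : p + r ≠ 0 := by omega
  refine add_eq_of_pow_eq_mul_pow h1R hpr ?_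
  rw [rMono_eq φ ht, rMono_eq φ ht₁, rMono_eq φ ht₂]
  unfold Phi
  rw [← hφ.pow_rElt (nat_mul_mem_frobRange l t.1) ht (p + r)
      (nat_mul_mem_frobRange' (nat_mul_mem_frobRange l t.1) _) (nat_mul_mem_frobRange' ht _),
    ← hφ.pow_rElt (nat_mul_mem_frobRange l t₁.1) ht₁ r
      (nat_mul_mem_frobRange' (nat_mul_mem_frobRange l t₁.1) _) (nat_mul_mem_frobRange' ht₁ _),
    ← hφ.pow_rElt (nat_mul_mem_frobRange l t₂.1) ht₂ p
      (nat_mul_mem_frobRange' (nat_mul_mem_frobRange l t₂.1) _) (nat_mul_mem_frobRange' ht₂ _),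
    ← hφ.mul_rElt (nat_mul_mem_frobRange' (nat_mul_mem_frobRange l t₁.1) _)
      (nat_mul_mem_frobRange' (nat_mul_mem_frobRange l t₂.1) _) (nat_mul_mem_frobRange' ht₁ _)
      (nat_mul_mem_frobRange' ht₂ _)
      (add_mem_frobRange (nat_mul_mem_frobRange' (nat_mul_mem_frobRange l t₁.1) _)
        (nat_mul_mem_frobRange' (nat_mul_mem_frobRange l t₂.1) _))
      (add_mem_frobRange (nat_mul_mem_frobRange' ht₁ _) (nat_mul_mem_frobRange' ht₂ _))]
  have hpc : ((p : ℕ) : ℝ) = t.1 - t₁.1 := by rw [hp, Nat.cast_sub h₁]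
  have hrc : ((r : ℕ) : ℝ) = t₂.1 - t.1 := by rw [hr, Nat.cast_sub h₂]
  simp only [mval] at hv₁ hv₂
  congr 1
  · exact rElt_congr _ _ (by push_cast; rw [hpc, hrc]; ring)
  · exact rElt_congr _ _ (by
      push_cast; rw [hpc, hrc]
      have e1 : t₁.2 = t.2 + (t.1 - t₁.1) * (l * l') := by linarith
      have e2 : t₂.2 = t.2 - (t₂.1 - t.1) * (l * l') := by linarith
      rw [e1, e2]; ring)

/-- The monomials `U^a V^b W^c ∈ R` obey the rules. [cite: ConnesConsani2016ArithmeticSite, Prop. 7.4 (proof of (ii))] -/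
theorem rMono_rules : MonoRules l l' (rMono φ) where
  one_add_one := hφ.one_add_one
  lt := fun _ _ ht ht' h => rMono_lt hl hl' φ hφ ht ht' h
  mid := fun _ _ _ ht ht₁ ht₂ hv₁ hv₂ h₁ h₂ => rMono_mid hl hl' φ hφ ht ht₁ ht₂ hv₁ hv₂ h₁ h₂
  add := fun _ _ ht ht' => rMono_add hl hl' φ hφ ht ht'
  zero := rMono_zero_zero hl hl' φ hφ

/-- **The homomorphism `ρ : ℛ_ε(λλ',λ') → R`** of Prop. 7.4 (ii).
[cite: ConnesConsani2016ArithmeticSite, Prop. 7.4 (ii)] -/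
def rho74Hom : epsSemiring l l' →+* R :=
  rhoGHom (rMono_rules hl hl' φ hφ) (mul_pos hl hl')

variable (hirr : Irrational l)
include hirr

/-- `φ = ρ ∘ ψ`. [cite: ConnesConsani2016ArithmeticSite, Prop. 7.4 (ii)] -/
theorem rho74Hom_epsPsi (a : frobSemiring l) (b : frobSemiring l') :
    rho74Hom hl hl' φ hφ (epsPsi l l' hirr a b) = φ a b := by
  rcases eq_zero_or_eq_rElt a with rfl | ⟨n, m, rfl⟩
  · rw [hφ.zero_left', show epsPsi l l' hirr 0 b = 0 from Subtype.ext (by simp [epsDelta_zero]), map_zero]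
  rcases eq_zero_or_eq_rElt b with rfl | ⟨n', m', rfl⟩
  · rw [hφ.zero_right', show epsPsi l l' hirr _ 0 = 0 from Subtype.ext (by simp), map_zero]
  have hβ' : (n' : ℝ) * l' + m' + m * l' ∈ frobRange l' :=
    add_mem_frobRange (mem_frobRange l' n' m') (nat_mul_mem_frobRange l' m)
  have hβ : (m : ℝ) * l' + (n' * l' + m') ∈ frobRange l' := by rw [add_comm]; exact hβ'
  rw [rho74Hom, rhoGHom_epsMono (rMono_rules hl hl' φ hφ) (mul_pos hl hl')
    ((n : ℕ), (m : ℝ) * l' + (n' * l' + m')) hβ _ (coe_epsPsi_rElt hirr n m _), rMono_eq φ hβ]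
  unfold Phi
  rw [hφ.bal_rElt (nat_mul_mem_frobRange l n) (mem_frobRange l' n' m') m (mem_frobRange l n m) hβ']
  congr 1
  exact rElt_congr _ _ (by dsimp only; ring)

/-- **Prop. 7.4 (ii), existence and uniqueness of `ρ`** for `(ℛ_ε(λλ',λ'), ψ)`, `λ` irrational.
[cite: ConnesConsani2016ArithmeticSite, Prop. 7.4 (ii)] -/
theorem existsUnique_rho74 :
    ∃! ρ : epsSemiring l l' →+* R, ∀ a b, ρ (epsPsi l l' hirr a b) = φ a b := by
  classical
  refine ⟨rho74Hom hl hl' φ hφ, rho74Hom_epsPsi hl hl' φ hφ hirr, fun ρ' hρ' => RingHom.ext fun x => ?_⟩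
  rcases exists_epsSum x.2 with hx | ⟨S, hS, hSa, hx⟩
  · rw [show x = 0 from Subtype.ext hx, map_zero, map_zero]
  -- `x = ∑_S ψ(q^{aλ}, q^β)` in `ℛ_ε`
  set f : ℕ × ℝ → epsSemiring l l' := fun t =>
    if h : t.2 ∈ frobRange l' then epsPsi l l' hirr (rElt l (t.1 * l) (nat_mul_mem_frobRange l t.1)) (rElt l' t.2 h)
    else 0 with hf
  have hxf : x = ∑ t ∈ S, f t := by
    apply Subtype.ext
    rw [hx, AddSubmonoidClass.coe_finsetSum]
    refine Finset.sum_congr rfl fun t ht => ?_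
    rw [hf]
    simp only [dif_pos (hSa t ht)]
    have := coe_epsPsi_rElt hirr (l' := l') t.1 0 (hSa t ht)
    simp only [Nat.cast_zero, add_zero, zero_mul, zero_add] at this
    rw [← this]
  rw [hxf, map_sum, map_sum]
  refine Finset.sum_congr rfl fun t ht => ?_
  rw [hf]
  simp only [dif_pos (hSa t ht)]
  rw [hρ', rho74Hom_epsPsi]

end Prop74

/-- **Connes–Consani 2016, Proposition 7.4 (ii)**: "Let `R` be a semiring and
`φ : ℛ(λ) × ℛ(λ') → R` be a bilinear map such that `φ(aa',bb') = φ(a,b)φ(a',b')` […] and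
`φ(r(λ)(x)a, b) = φ(a, ℓ(λ')(x)b)` […]. Then there exists a unique homomorphism
`ρ : ℛ_ε(λλ',λ') → R` such that `φ = ρ ∘ ψ`." (`R` multiplicatively cancellative as in the printed
proof; the printed hypotheses `λ' ∉ ℚ`, `λλ' ∈ ℚλ' + ℚ` are not needed — only `λ ∉ ℚ`.)
[cite: ConnesConsani2016ArithmeticSite, Prop. 7.4 (ii)] -/
theorem ConnesConsani2016_prop_7_4_ii {l l' : ℝ} (hl : 0 < l) (hl' : 0 < l') (hirr : Irrational l)
    {R : Type} [CommSemiring R] [IsCancelMulZero R] (φ : frobSemiring l → frobSemiring l' → R)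
    (hφ : IsBalancedBimul (frobCorrespondence l hl) (frobCorrespondence l' hl') φ) :
    ∃! ρ : epsSemiring l l' →+* R, ∀ a b, ρ (epsPsi l l' hirr a b) = φ a b :=
  existsUnique_rho74 hl hl' φ hφ hirr

/-- **Proposition 7.4 packaged**: for `λ` irrational, `(ℛ_ε(λλ',λ'), ψ)` is the reduced semiring of
`ℛ(λ) ⊗_{ℤ_min⁺} ℛ(λ')` ("By Proposition 7.4 the reduction of `ℛ(λ) ⊗_{ℤ_min⁺} ℛ(λ')` is
`ℛ_ε(λλ',λ')`", proof of Thm. 7.7). [cite: ConnesConsani2016ArithmeticSite, Prop. 7.4 and §7.4 (proof of Thm. 7.7)] -/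
theorem ConnesConsani2016_prop_7_4 {l l' : ℝ} (hl : 0 < l) (hl' : 0 < l') (hirr : Irrational l) :
    IsTensorReduction (frobCorrespondence l hl) (frobCorrespondence l' hl') (epsSemiring l l')
      (epsPsi l l' hirr) :=
  ⟨inferInstance, ConnesConsani2016_prop_7_4_i hl hl' hirr, fun _ _ _ φ hφ =>
    existsUnique_rho74 hl hl' φ hφ hirr⟩


/-! ## Theorem 7.7 through `ℛ_ε(λλ',λ')`: the sub-semiring generated by `ℓ(ℤ_min⁺)` and `r(ℤ_min⁺)` -/

/-- **The correspondence (70)**: "the sub-semiring of `𝒢` generated by the `q^{(1+ε)αi + k}` for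
`i, k ∈ ℕ`, with left action of `q` given by `i ↦ i+1` and right action by `k ↦ k+1`" — for any
`α > 0`; it is the sub-semiring of `ℛ_ε(λλ',λ')` (`α = λλ'`) "generated by the `ℓ(q^n)` and
`r(q^m)`". For `α = 1` it is `Id_ε` on the nose; for `α ∉ ℚ` "the evaluation at `ε = 0` is an
isomorphism `R → ℛ(α)`"; for `α ∈ ℚ` it is `Id_ε ∘ Ψ(α)` (Lemma 7.8, not typed here).
[cite: ConnesConsani2016ArithmeticSite, §7.4 (proof of Thm. 7.7, eq. (70))] -/
abbrev germSemiring (α : ℝ) : Subsemiring GermExp :=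
  Subsemiring.closure {gaff 1 0, gaff α α}

/-- Left action on (70): `q^n ↦ q^{(1+ε)αn}`. [cite: ConnesConsani2016ArithmeticSite, §7.4 eq. (70)] -/
def germEll (α : ℝ) (hα : 0 < α) : ℕ̄ →+* germSemiring α :=
  (gpowHom α α hα).codRestrict (germSemiring α)
    (gpowHom_mem hα (Subsemiring.subset_closure (by simp)))

/-- Right action on (70): `q^n ↦ q^n`. [cite: ConnesConsani2016ArithmeticSite, §7.4 eq. (70)] -/
def germR (α : ℝ) : ℕ̄ →+* germSemiring α :=
  (gpowHom 1 0 one_pos).codRestrict (germSemiring α)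
    (gpowHom_mem one_pos (Subsemiring.subset_closure (by simp)))

/-- The left action on (70) in `𝒢`. [cite: ConnesConsani2016ArithmeticSite, §7.4 eq. (70)] -/
@[simp] theorem coe_germEll (α : ℝ) (hα : 0 < α) (x : ℕ̄) : (germEll α hα x : GermExp) = gpowHom α α hα x := rfl
/-- The right action on (70) in `𝒢`. [cite: ConnesConsani2016ArithmeticSite, §7.4 eq. (70)] -/
@[simp] theorem coe_germR (α : ℝ) (x : ℕ̄) : (germR α x : GermExp) = gpowHom 1 0 one_pos x := rfl

/-- **The reduced correspondence (70)** `(⟨q^{(1+ε)α}, q⟩ ⊂ 𝒢, ℓ, r)`.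
[cite: ConnesConsani2016ArithmeticSite, §7.4 (proof of Thm. 7.7, eq. (70))] -/
abbrev germComp (α : ℝ) (hα : 0 < α) : ReducedCorrespondence where
  R := germSemiring α
  ell := germEll α hα
  r := germR α
  ell_eq_zero_iff x := by
    rw [← Subtype.coe_inj, Subsemiring.coe_zero, coe_germEll]
    exact gpowHom_eq_zero_iff α α hα x
  r_eq_zero_iff x := by
    rw [← Subtype.coe_inj, Subsemiring.coe_zero, coe_germR]
    exact gpowHom_eq_zero_iff 1 0 one_pos x
  closure_eq_top := by
    refine closure_range_mul_range_eq_top (germEll α hα) (germR α) fun g hg => ?_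
    simp only [Set.mem_insert_iff, Set.mem_singleton_iff] at hg
    rcases hg with rfl | rfl
    · exact ⟨1, nexp 1, Subtype.ext (by simp)⟩
    · exact ⟨nexp 1, 1, Subtype.ext (by simp)⟩

/-- "For `λλ' = 1` the sub-semiring […] generated by the `ℓ(q^n)` and `r(q^m)` is isomorphic to `𝔹_ε`
with left and right actions given as in Definition 7.6": (70) for `α = 1` IS `Id_ε`.
[cite: ConnesConsani2016ArithmeticSite, §7.4 (proof of Thm. 7.7)] -/
theorem germComp_one : germComp 1 one_pos = idEps := rfl

/-- (70) only depends on the real number `α`. [cite: ConnesConsani2016ArithmeticSite, §7.4 eq. (70)] -/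
theorem germComp_congr {α β : ℝ} (hα : 0 < α) (hβ : 0 < β) (h : α = β) :
    (germComp α hα).Iso (germComp β hβ) := by
  subst h
  exact ReducedCorrespondence.Iso.refl _

/-- (70) sits inside `ℛ_ε(λλ', λ')`. [cite: ConnesConsani2016ArithmeticSite, §7.4 (proof of Thm. 7.7)] -/
theorem germSemiring_le_epsSemiring (l l' : ℝ) : germSemiring (l * l') ≤ epsSemiring l l' := by
  refine Subsemiring.closure_le.2 ?_
  rintro g hg
  simp only [Set.mem_insert_iff, Set.mem_singleton_iff] at hg
  rcases hg with rfl | rfl <;> exact Subsemiring.subset_closure (by simp)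

/-- `ℓ(λ)(q^k) = q^{kλ + 0}`. [cite: ConnesConsani2016ArithmeticSite, §7.1 eq. (58)] -/
theorem frobEll_nexp_eq_rElt (l : ℝ) (hl : 0 < l) (k : ℕ) :
    frobEll l hl (nexp k) = rElt l (k * l + (0 : ℕ)) (mem_frobRange l k 0) :=
  Subtype.ext (by simp)

/-- `r(λ)(q^k) = q^{0λ + k}`. [cite: ConnesConsani2016ArithmeticSite, §7.1 eq. (58)] -/
theorem frobR_nexp_eq_rElt (l : ℝ) (k : ℕ) :
    frobR l (nexp k) = rElt l ((0 : ℕ) * l + k) (mem_frobRange l 0 k) :=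
  Subtype.ext (by simp)

/-- **The composition datum for `λ ∉ ℚ`**: by Prop. 7.4 the reduction of `ℛ(λ) ⊗ ℛ(λ')` is
`ℛ_ε(λλ',λ')` with "`ℓ(q^n)X = q^{(1+ε)λλ'n}X`, `r(q^n)X = q^n X`" (eq. (70)), and the sub-semiring
generated by `ℓ(ℤ_min⁺)`, `r(ℤ_min⁺)` is (70) with `α = λλ'`.
[cite: ConnesConsani2016ArithmeticSite, §7.4 (proof of Thm. 7.7)] -/
def germCompositionDatum {l l' : ℝ} (hl : 0 < l) (hl' : 0 < l') (hirr : Irrational l) :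
    CompositionDatum (frobCorrespondence l hl) (frobCorrespondence l' hl')
      (germComp (l * l') (mul_pos hl hl')) where
  T := epsSemiring l l'
  ψ := epsPsi l l' hirr
  isTensorReduction := ConnesConsani2016_prop_7_4 hl hl' hirr
  emb := Subsemiring.inclusion (germSemiring_le_epsSemiring l l')
  emb_injective := Subsemiring.inclusion_injective _
  emb_ell x := Subtype.ext (by
    show (gpowHom (l * l') (l * l') (mul_pos hl hl') x : GermExp) =
      epsDelta l l' (frobEll l hl x) * gconst ((1 : frobSemiring l') : 𝕋)
    rw [Subsemiring.coe_one, map_one, mul_one]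
    rcases eq_zero_or_eq_nexp x with rfl | ⟨k, rfl⟩
    · rw [map_zero, map_zero, epsDelta_zero]
    · rw [gpowHom_nexp, frobEll_nexp_eq_rElt, epsDelta_rElt hirr]
      simp)
  emb_r x := Subtype.ext (by
    show (gpowHom 1 0 one_pos x : GermExp) =
      epsDelta l l' (1 : frobSemiring l) * gconst ((frobR l' x : frobSemiring l') : 𝕋)
    rw [epsDelta_one hirr, one_mul]
    rcases eq_zero_or_eq_nexp x with rfl | ⟨k, rfl⟩
    · rw [map_zero, map_zero, Subsemiring.coe_zero, map_zero]
    · rw [gpowHom_nexp, coe_frobR_nexp, gconst_texp]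
      simp)

/-- **Theorem 7.7 via Proposition 7.4, `λ ∉ ℚ` (any `λ' > 0`)**: `Ψ(λ) ∘ Ψ(λ')` is the
correspondence (70) with `α = λλ'` — the common content of the two displayed conclusions of the
printed proof ("the evaluation at `ε = 0` is an isomorphism `R → ℛ(α)`" when `α ∉ ℚ`; "This coincides
with (70)" when `α ∈ ℚ`). [cite: ConnesConsani2016ArithmeticSite, Thm. 7.7 (proof, §7.4)] -/
theorem ConnesConsani2016_thm_7_7_irrational_left {l l' : ℝ} (hl : 0 < l) (hl' : 0 < l')
    (hirr : Irrational l) :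
    IsComposition (frobCorrespondence l hl) (frobCorrespondence l' hl') (germComp (l * l') (mul_pos hl hl')) :=
  ⟨germCompositionDatum hl hl' hirr⟩

/-- `q^{nα + m + nαε} ∈ ⟨q, q^{(1+ε)α}⟩`. [cite: ConnesConsani2016ArithmeticSite, §7.4 eq. (70)] -/
theorem gaff_mem_germSemiring (α : ℝ) (n m : ℕ) : gaff (n * α + m) (n * α) ∈ germSemiring α := by
  have e : gaff (n * α + m) (n * α) = gaff α α ^ n * gaff 1 0 ^ m := by
    rw [gaff_pow, gaff_pow, gaff_mul]; ring_nf
  rw [e]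
  exact Subsemiring.mul_mem _ (Subsemiring.pow_mem _ (Subsemiring.subset_closure (by simp)) n)
    (Subsemiring.pow_mem _ (Subsemiring.subset_closure (by simp)) m)

/-- `δ : ℛ(α) → ⟨q, q^{(1+ε)α}⟩`, `q^{nα+m} ↦ q^{(1+ε)αn + m}` (the inverse of the evaluation at
`ε = 0`). [cite: ConnesConsani2016ArithmeticSite, §7.4 (proof of Thm. 7.7: "the evaluation at `ε = 0` is an isomorphism `R → ℛ(α)`")] -/
def germDelta {α : ℝ} (hirr : Irrational α) : frobSemiring α →+* germSemiring α :=
  (epsDeltaHom (l := α) (l' := 1) hirr one_pos).codRestrict (germSemiring α) fun a => by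
    rcases eq_zero_or_eq_rElt a with rfl | ⟨n, m, rfl⟩
    · rw [map_zero]; exact Subsemiring.zero_mem _
    · rw [epsDeltaHom_apply, epsDelta_rElt hirr]
      have := gaff_mem_germSemiring α n m
      convert this using 2 <;> ring

/-- `δ` in `𝒢`. [cite: ConnesConsani2016ArithmeticSite, §7.4 (proof of Thm. 7.7)] -/
theorem coe_germDelta {α : ℝ} (hirr : Irrational α) (a : frobSemiring α) :
    (germDelta hirr a : GermExp) = epsDelta α 1 a := rfl

/-- `δ : ℛ(α) → ⟨q, q^{(1+ε)α}⟩` is bijective for `α ∉ ℚ` (its inverse is the evaluation at `ε = 0`). [cite: ConnesConsani2016ArithmeticSite, §7.4 (proof of Thm. 7.7)] -/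
theorem germDelta_bijective {α : ℝ} (hα : 0 < α) (hirr : Irrational α) :
    Function.Bijective (germDelta hirr) := by
  refine ⟨fun a b h => epsDelta_injective hirr hα one_pos (congrArg Subtype.val h), fun y => ?_⟩
  obtain ⟨y, hy⟩ := y
  induction hy using Subsemiring.closure_induction with
  | mem g hg =>
    simp only [Set.mem_insert_iff, Set.mem_singleton_iff] at hg
    rcases hg with rfl | rfl
    · refine ⟨rElt α ((0 : ℕ) * α + (1 : ℕ)) (mem_frobRange α 0 1), Subtype.ext ?_⟩
      rw [coe_germDelta, epsDelta_rElt hirr]; simp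
    · refine ⟨rElt α ((1 : ℕ) * α + (0 : ℕ)) (mem_frobRange α 1 0), Subtype.ext ?_⟩
      rw [coe_germDelta, epsDelta_rElt hirr]; simp
  | zero => exact ⟨0, Subtype.ext (by rw [map_zero]; rfl)⟩
  | one => exact ⟨1, Subtype.ext (by rw [map_one]; rfl)⟩
  | add a b _ _ iha ihb =>
    obtain ⟨x, hx⟩ := iha
    obtain ⟨y, hy⟩ := ihb
    exact ⟨x + y, Subtype.ext (by rw [map_add, Subsemiring.coe_add, hx, hy])⟩
  | mul a b _ _ iha ihb =>
    obtain ⟨x, hx⟩ := iha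
    obtain ⟨y, hy⟩ := ihb
    exact ⟨x * y, Subtype.ext (by rw [map_mul, Subsemiring.coe_mul, hx, hy])⟩

/-- **"the evaluation at `ε = 0` is an isomorphism `R → ℛ(α)`"** (`α ∉ ℚ`): the correspondence (70)
is `Ψ(α)`. [cite: ConnesConsani2016ArithmeticSite, §7.4 (proof of Thm. 7.7)] -/
theorem germComp_iso_frob {α : ℝ} (hα : 0 < α) (hirr : Irrational α) :
    (germComp α hα).Iso (frobCorrespondence α hα) := by
  let e : frobSemiring α ≃+* germSemiring α := RingEquiv.ofBijective (germDelta hirr) (germDelta_bijective hα hirr)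
  refine ⟨e.symm, fun x => e.symm_apply_eq.2 (Subtype.ext ?_), fun x => e.symm_apply_eq.2 (Subtype.ext ?_)⟩
  · show (gpowHom α α hα x : GermExp) = epsDelta α 1 (frobEll α hα x)
    rcases eq_zero_or_eq_nexp x with rfl | ⟨k, rfl⟩
    · rw [map_zero, map_zero, epsDelta_zero]
    · rw [gpowHom_nexp, frobEll_nexp_eq_rElt, epsDelta_rElt hirr]; simp
  · show (gpowHom 1 0 one_pos x : GermExp) = epsDelta α 1 (frobR α x)
    rcases eq_zero_or_eq_nexp x with rfl | ⟨k, rfl⟩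
    · rw [map_zero, map_zero, epsDelta_zero]
    · rw [gpowHom_nexp, frobR_nexp_eq_rElt, epsDelta_rElt hirr]; simp

/-- **Theorem 7.7, `λ ∉ ℚ` and `λλ' ∉ ℚ`**: `Ψ(λ) ∘ Ψ(λ') = Ψ(λλ')` — including the sub-case
`λλ' ∈ ℚλ' + ℚ` not covered by Prop. 7.3 ("Assume first that `λλ' ∉ ℚ`. Let us show that the
sub-semiring `R` of `ℛ_ε(λλ',λ')` generated by the `ℓ(q^n)` and `r(q^m)` is isomorphic to `ℛ(λλ')`
[…]"). [cite: ConnesConsani2016ArithmeticSite, Thm. 7.7 (proof, §7.4)] -/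
theorem ConnesConsani2016_thm_7_7_irrational {l l' : ℝ} (hl : 0 < l) (hl' : 0 < l')
    (hirr : Irrational l) (hirr₂ : Irrational (l * l')) :
    IsComposition (frobCorrespondence l hl) (frobCorrespondence l' hl')
      (frobCorrespondence (l * l') (mul_pos hl hl')) :=
  (ConnesConsani2016_thm_7_7_irrational_left hl hl' hirr).of_iso
    (germComp_iso_frob (mul_pos hl hl') hirr₂).symm

/-- **Connes–Consani 2016, Theorem 7.7 (= Thm. 1.2 = CRAS 2014 Thm. 4.1), first sentence, in
full**: "Let `λ, λ' ∈ ℝ₊*` such that `λλ' ∉ ℚ`. The composition of the Frobenius correspondences is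
then given by `Ψ(λ) ∘ Ψ(λ') = Ψ(λλ')`." (`λ ∉ ℚ`: Prop. 7.4 and the evaluation at `ε = 0`; `λ ∈ ℚ`:
`ConnesConsani2016_thm_7_7_of_rat_left`.) [cite: ConnesConsani2016ArithmeticSite, Thm. 7.7] -/
theorem ConnesConsani2016_thm_7_7 {l l' : ℝ} (hl : 0 < l) (hl' : 0 < l') (h : Irrational (l * l')) :
    IsComposition (frobCorrespondence l hl) (frobCorrespondence l' hl')
      (frobCorrespondence (l * l') (mul_pos hl hl')) := by
  by_cases hirr : Irrational l
  · exact ConnesConsani2016_thm_7_7_irrational hl hl' hirr h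
  · have hq : ∃ q : ℚ, (q : ℝ) = l := by
      unfold Irrational at hirr
      simpa using hirr
    exact ConnesConsani2016_thm_7_7_of_rat_left hl hl' hq

/-- **Theorem 7.7, third sentence, as computed in the proof**: for `λ, λ'` irrational with
`λλ' ∈ ℚ`, `Ψ(λ) ∘ Ψ(λ')` is the correspondence (70) with `α = λλ'` ("One gets the sub-semiring of `𝒢`
generated by the `q^{(1+ε)αi + k}` […]. This coincides with (70) and thus shows that
`Ψ(λ) ∘ Ψ(λ') = Id_ε ∘ Ψ(λλ')`"); the identification of (70) with `Id_ε ∘ Ψ(λλ')` is Lemma 7.8 (ii),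
not typed in this file. [cite: ConnesConsani2016ArithmeticSite, Thm. 7.7 (proof, §7.4, eq. (70))] -/
theorem ConnesConsani2016_thm_7_7_resonant {l l' : ℝ} (hl : 0 < l) (hl' : 0 < l')
    (hirr : Irrational l) (_hirr' : Irrational l') (_hq : ∃ q : ℚ, (q : ℝ) = l * l') :
    IsComposition (frobCorrespondence l hl) (frobCorrespondence l' hl') (germComp (l * l') (mul_pos hl hl')) :=
  ConnesConsani2016_thm_7_7_irrational_left hl hl' hirr

/-- **"`Ψ(λ) ∘ Ψ(λ⁻¹) = Id_ε`"** for irrational `λ` ("For `λλ' = 1` the sub-semiring `R` of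
`ℛ_ε(λλ',λ')` generated by the `ℓ(q^n)` and `r(q^m)` is isomorphic to `𝔹_ε` with left and right
actions given as in Definition 7.6"). [cite: ConnesConsani2016ArithmeticSite, Thm. 7.7 (proof, §7.4)] -/
theorem ConnesConsani2016_thm_7_7_inverse {l : ℝ} (hl : 0 < l) (hirr : Irrational l) :
    IsComposition (frobCorrespondence l hl) (frobCorrespondence l⁻¹ (inv_pos.2 hl)) idEps := by
  have h := ConnesConsani2016_thm_7_7_irrational_left hl (inv_pos.2 hl) hirr
  refine h.of_iso ?_
  rw [← germComp_one]
  exact germComp_congr one_pos _ (mul_inv_cancel₀ hl.ne').symm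


end Literature.NumberTheory.ConnesConsani
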